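import Mathlib
import HarnessLib
import Literature.Probability.MarkovChains.SpectralGapVariational

/-!
# The Density Decomposition Theorem of Madras and Randall (Ann. Appl. Probab. 12 (2002),
# Theorem 1.2): the spectral gap of a Metropolis–Hastings chain for a mixture target

HONEST FRAMING: exact (Metropolis-corrected) sampling algorithms for lattice gauge theory; figures
of merit are autocorrelation/cost numbers at stated couplings and volumes; no continuum-physics claim.

Conventions of `MetropolisHastings.lean` / `PeskunOrdering.lean` / `SpectralGapVariational.lean`:
finite state space `X` (the paper's `Ω` with counting reference measure `λ`), proposal kernel
`R : X → X → ℝ`, `mhRate R φ` / `mhKernel R φ` = the Metropolis–Hastings chain `R[φ]` for the target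
`φ` (eq. (9)/(21) of the paper: off the diagonal `R(x,y) min{1, φ(y)R(y,x)/(φ(x)R(x,y))}`, with the
paper's convention "if the denominator is `0`, then we take `R[ζ](x,dy) = 0`", which is what the
tree's `min (R x y) (φ y R y x / φ x)` gives for `φ(x) = 0`, `R ≥ 0`), `lawMean`, `lawVariance`,
`dirichletForm φ P f = ½ Σ_{x,y} φ(x)P(x,y)(f(x) − f(y))²`, `spectralGapR φ P = Gap` (the variational
gap (7) of the paper: `Gap(R) = inf_f Σ|f(x)−f(y)|²ρ(dx)R(x,dy) / Σ|f(x)−f(y)|²ρ(dx)ρ(dy)`, the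
denominator being `2 Var_ρ f`).  Source READ: N. Madras, D. Randall, *Markov chain decomposition for
convergence rate analysis*, Ann. Appl. Probab. 12 (2002) 581–606 [MadrasRandall2002], §1
(Theorem 1.2, eqs. (9)–(12)) and §5 (its proof, eqs. (40)–(48)), fetched open-access from Project
Euclid by the hub's literature service.  Everything is PROVED (finite sums; 0 named facts).

THE SETTING [cite: MadrasRandall2002, §1 Theorem 1.2].  Indices `j = 0, …, D` are natural numbers
`≤ D`; `φ : ℕ → X → ℝ` are the densities `φ_0, …, φ_D` (probability vectors), `a : ℕ → ℝ` the
positive weights adding up to `1`, `mixture a φ D = φ_mix := Σ_{j ≤ D} a_j φ_j` (eq. (10)); the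
overlap hypothesis (11) is `Σ_x min{φ_j(x), φ_{j+1}(x)} ≥ δ` for `j < D`.
* `mhFlux φ R x y = min{φ(x)R(x,y), φ(y)R(y,x)}` — the edge weight of `R[φ]`:
  `φ(x)·R[φ](x,y) = mhFlux φ R x y` off the diagonal (`mul_mhRate_of_nonneg`, for `φ ≥ 0`, `R ≥ 0`),
  so that `B_φ(f) := Σ_{x,y}(f(x) − f(y))² mhFlux φ R x y = 2𝓔_φ(R[φ]; f)` (`dirichletForm_mhKernel`;
  the paper's `B_j`, eq. (40) `Gap_j = inf_f B_j(f)/2V_j(f)`);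
* `pairForm p q f = C(p,q)(f) := Σ_{x,y} p(x)q(y)(f(x) − f(y))²` (the paper's `C_{ij}(f)` for
  `p = φ_i`, `q = φ_j`; `pairForm_self : C(p,p) = 2 Var_p f`).

THE PROOF, step by step [cite: MadrasRandall2002, §5]:
* (41) `mhFlux_mixture_ge`: `min` is superadditive, so `mhFlux φ_mix ≥ Σ a_j mhFlux φ_j` and
  `B_mix(f) ≥ Σ_j a_j B_j(f)` (`dirichletForm_mixture_ge`);
* (43) `two_mul_lawVariance_mixture`: `2V_mix(f) = Σ_{i,j} a_i a_j C_{ij}(f)`;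
* (44)–(47) `pairForm_le_of_overlap`: the overlap (11) gives **`δ C_{j,j+1}(f) ≤ (2 − δ)(V_j(f) + V_{j+1}(f))`**
  (division-free form of (47); the decomposition `φ_j = δη + (φ_j − δη)`, `η := min{φ_j,φ_{j+1}}/s`,
  `s := Σ min ≥ δ`, is used with the unnormalised remainders, which also covers `δ = 1`);
* (48) `pairForm_le_path`: `C_{ij}(f) ≤ (j − i) Σ_{k=i}^{j−1} C_{k,k+1}(f)` (the Schwarz step, here by
  induction with the weighted triangle inequality `n C(p,q) ≤ (n+1) C(p,η) + n(n+1) C(η,q)`), hence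
  `C_{ij}(f) ≤ (2(2−δ)D/δ) Σ_l V_l(f)` for all `i, j ≤ D` and (42) `2V_mix(f) ≤ (2(2−δ)D/δ) Σ_l V_l(f)`;
* **THEOREM 1.2** `MadrasRandall2002_thm_1_2` (Poincaré form: if `𝓔_j ≥ λ_j V_j` for all `j` then
  `𝓔_mix ≥ (δ/2D)·(min_j a_jλ_j)·V_mix`) and `MadrasRandall2002_thm_1_2_spectralGapR` (as printed:
  **`Gap_mix ≥ (δ/2D) min_j a_j Gap_j`**).

GENERALITY NOTE (typed hypotheses ⊆ printed ones): the paper assumes the proposal `R` reversible with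
respect to some density `ρ` (to write `R[ζ]` in the form (9)); the proof of Theorem 1.2 uses only the
edge weights `min{φ(x)R(x,y), φ(y)R(y,x)}`, so here `R` is ANY entrywise non-negative matrix and the
targets `φ_j ≥ 0` may vanish somewhere (the paper's convention for zero denominators).  The sharper
intermediate constant `2(2−δ)D/δ` of (48) is kept in `two_mul_lawVariance_mixture_le`, while
Theorem 1.2 is stated with the printed `δ/(2D)`.  NOT typed: the Remark after the proof (non-linearly arranged
overlaps, diameter `M` of the overlap graph), Theorem 1.1 (state decomposition) and Theorem 2.1
(Caracciolo–Pelissetto–Sokal).  Context (cell pub-lqcd): a Metropolis sampler for a multimodal target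
written as a mixture of overlapping unimodal pieces (umbrella / tempering-like bridges between
topological sectors) mixes no slower than `δ/(2D)` times its slowest weighted piece.
-/

namespace Literature.Probability.MarkovChains.DensityDecomposition

open Finset

variable {X : Type*} [Fintype X] [DecidableEq X]

/-! ## Edge weights of a Metropolis–Hastings chain and the form `C(p,q)` -/

omit [Fintype X] [DecidableEq X] in
/-- The edge weight `min{φ(x)R(x,y), φ(y)R(y,x)}` of the Metropolis–Hastings chain `R[φ]`.
[cite: MadrasRandall2002, §5 (the weight `R(x,dy) min{φ_j(x)/ρ(x), φ_j(y)/ρ(y)} ρ(x)` in the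
definition of `B_j(f)`, `= min{φ_j(x)R(x,dy), φ_j(y)R(y,dx)}` for a `ρ`-reversible `R`)] -/
noncomputable def mhFlux (φ : X → ℝ) (R : X → X → ℝ) (x y : X) : ℝ :=
  min (φ x * R x y) (φ y * R y x)

omit [Fintype X] [DecidableEq X] in
/-- `mhFlux` is symmetric. [cite: MadrasRandall2002, §1 ("It is easy to check that `R[ζ]` is
reversible with respect to `ζ`")] -/
theorem mhFlux_comm (φ : X → ℝ) (R : X → X → ℝ) (x y : X) : mhFlux φ R x y = mhFlux φ R y x :=
  min_comm _ _

omit [Fintype X] [DecidableEq X] in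
/-- `mhFlux ≥ 0` for `φ ≥ 0`, `R ≥ 0`. [cite: MadrasRandall2002, §5 (definition of `B_j`)] -/
theorem mhFlux_nonneg {φ : X → ℝ} (hφ : ∀ x, 0 ≤ φ x) {R : X → X → ℝ} (hR : ∀ x y, 0 ≤ R x y)
    (x y : X) : 0 ≤ mhFlux φ R x y :=
  le_min (mul_nonneg (hφ x) (hR x y)) (mul_nonneg (hφ y) (hR y x))

omit [Fintype X] [DecidableEq X] in
/-- `φ(x) · (R[φ] rate from x to y) = min{φ(x)R(x,y), φ(y)R(y,x)}` for `φ ≥ 0`, `R ≥ 0` (the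
paper's convention `R[ζ](x,dy) = 0` when `ζ(x) = 0` is the tree's `min (R x y) (φ y R y x / 0)`).
[cite: MadrasRandall2002, §1 eq. (9) with "[If the denominator `ζ(x)ρ(y)` is `0`, then we take
`R[ζ](x,dy) = 0`.]"] -/
theorem mul_mhRate_of_nonneg {φ : X → ℝ} (hφ : ∀ x, 0 ≤ φ x) {R : X → X → ℝ}
    (hR : ∀ x y, 0 ≤ R x y) (x y : X) : φ x * mhRate R φ x y = mhFlux φ R x y := by
  unfold mhRate mhFlux
  rcases (hφ x).eq_or_lt with h0 | hpos
  · rw [← h0, zero_mul, zero_mul]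
    exact (min_eq_left (mul_nonneg (hφ y) (hR y x))).symm
  · rw [(monotone_mul_left_of_nonneg hpos.le).map_min]
    congr 1
    rw [mul_div_assoc', mul_div_cancel_left₀ _ hpos.ne']

omit [DecidableEq X] in
/-- `C(p,q)(f) := Σ_{x,y} p(x)q(y)(f(x) − f(y))²` (the paper's `C_{ij}(f)` for `p = φ_i`,
`q = φ_j`). [cite: MadrasRandall2002, §5 (definition of `C_{ij}(f)`)] -/
def pairForm (p q : X → ℝ) (f : X → ℝ) : ℝ := ∑ x, ∑ y, p x * q y * (f x - f y) ^ 2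

omit [DecidableEq X] in
/-- `C(p,q) ≥ 0` for `p, q ≥ 0`. [cite: MadrasRandall2002, §5] -/
theorem pairForm_nonneg {p q : X → ℝ} (hp : ∀ x, 0 ≤ p x) (hq : ∀ x, 0 ≤ q x) (f : X → ℝ) :
    0 ≤ pairForm p q f :=
  sum_nonneg fun x _ => sum_nonneg fun y _ => mul_nonneg (mul_nonneg (hp x) (hq y)) (sq_nonneg _)

omit [DecidableEq X] in
/-- `C(p,q) = C(q,p)`. [cite: MadrasRandall2002, §5] -/
theorem pairForm_comm (p q : X → ℝ) (f : X → ℝ) : pairForm p q f = pairForm q p f := by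
  unfold pairForm
  rw [sum_comm]
  exact sum_congr rfl fun x _ => sum_congr rfl fun y _ => by ring

omit [DecidableEq X] in
/-- `C` is additive in the first slot. [cite: MadrasRandall2002, §5 eqs. (44)–(45) (bilinear
expansion)] -/
theorem pairForm_add_left (p₁ p₂ q : X → ℝ) (f : X → ℝ) :
    pairForm (fun x => p₁ x + p₂ x) q f = pairForm p₁ q f + pairForm p₂ q f := by
  unfold pairForm
  rw [← sum_add_distrib]
  refine sum_congr rfl fun x _ => ?_
  rw [← sum_add_distrib]
  exact sum_congr rfl fun y _ => by ring

omit [DecidableEq X] in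
/-- `C` is homogeneous in the first slot. [cite: MadrasRandall2002, §5 eqs. (44)–(45)] -/
theorem pairForm_smul_left (c : ℝ) (p q : X → ℝ) (f : X → ℝ) :
    pairForm (fun x => c * p x) q f = c * pairForm p q f := by
  unfold pairForm
  rw [mul_sum]
  refine sum_congr rfl fun x _ => ?_
  rw [mul_sum]
  exact sum_congr rfl fun y _ => by ring

omit [DecidableEq X] in
/-- `C` is additive in the second slot. [cite: MadrasRandall2002, §5 eqs. (44)–(45)] -/
theorem pairForm_add_right (p q₁ q₂ : X → ℝ) (f : X → ℝ) :
    pairForm p (fun x => q₁ x + q₂ x) f = pairForm p q₁ f + pairForm p q₂ f := by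
  rw [pairForm_comm, pairForm_add_left, pairForm_comm q₁, pairForm_comm q₂]

omit [DecidableEq X] in
/-- `C` is homogeneous in the second slot. [cite: MadrasRandall2002, §5 eqs. (44)–(45)] -/
theorem pairForm_smul_right (c : ℝ) (p q : X → ℝ) (f : X → ℝ) :
    pairForm p (fun x => c * q x) f = c * pairForm p q f := by
  rw [pairForm_comm, pairForm_smul_left, pairForm_comm]


/-! ## `C(p,p) = 2 Var_p`, and the three-point inequalities -/

omit [DecidableEq X] in
/-- `C_{jj}(f) = 2V_j(f)` for a probability vector. [cite: MadrasRandall2002, §5 ("`C_{jj}(f) =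
2V_j(f)`")] -/
theorem pairForm_self {p : X → ℝ} (hp1 : ∑ x, p x = 1) (f : X → ℝ) :
    pairForm p p f = 2 * lawVariance p f := by
  set m := lawMean p f with hm
  have hc : ∑ x, p x * (f x - m) = 0 := sum_mul_sub_lawMean hp1 f
  have hV : lawVariance p f = ∑ x, p x * (f x - m) ^ 2 := rfl
  have hx : ∀ x y, p x * p y * (f x - f y) ^ 2
      = p y * (p x * (f x - m) ^ 2) + p x * (p y * (f y - m) ^ 2)
        - 2 * ((p x * (f x - m)) * (p y * (f y - m))) := fun x y => by ring
  unfold pairForm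
  simp_rw [hx, sum_sub_distrib, sum_add_distrib]
  have h1 : ∑ x, ∑ y, p y * (p x * (f x - m) ^ 2) = lawVariance p f := by
    rw [hV, sum_comm]
    simp_rw [← mul_sum]
    rw [← sum_mul, hp1, one_mul]
  have h2 : ∑ x, ∑ y, p x * (p y * (f y - m) ^ 2) = lawVariance p f := by
    rw [hV]
    simp_rw [← mul_sum]
    rw [← sum_mul, hp1, one_mul]
  have h3 : ∑ x, ∑ y, 2 * ((p x * (f x - m)) * (p y * (f y - m))) = 0 := by
    have h3a : ∀ x, ∑ y, 2 * ((p x * (f x - m)) * (p y * (f y - m)))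
        = 2 * (p x * (f x - m)) * ∑ y, p y * (f y - m) := fun x => by
      rw [mul_sum]
      exact sum_congr rfl fun y _ => by ring
    simp_rw [h3a, hc, mul_zero, sum_const_zero]
  rw [h1, h2, h3]
  ring

omit [DecidableEq X] in
/-- The generic three-point step: if `(u + v)² ≤ αu² + βv²` for all reals, then inserting an
intermediate point `z ∼ η` (a probability vector) gives
`C(p,q) ≤ α (Σ q) C(p,η) + β (Σ p) C(η,q)` for `p, q, η ≥ 0`. [cite: MadrasRandall2002, §5 (the step
"Using `(u+v)² ≤ 2u² + 2v²`, we obtain …" before eq. (47), and the Schwarz step of eq. (48))] -/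
theorem pairForm_three_point {p q η : X → ℝ} (hp : ∀ x, 0 ≤ p x) (hq : ∀ x, 0 ≤ q x)
    (hη : ∀ x, 0 ≤ η x) (hη1 : ∑ x, η x = 1) {α β : ℝ}
    (hαβ : ∀ u v : ℝ, (u + v) ^ 2 ≤ α * u ^ 2 + β * v ^ 2) (f : X → ℝ) :
    pairForm p q f ≤ α * (∑ y, q y) * pairForm p η f + β * (∑ x, p x) * pairForm η q f := by
  unfold pairForm
  -- insert `Σ_z η z = 1`
  have hL : ∑ x, ∑ y, p x * q y * (f x - f y) ^ 2
      = ∑ x, ∑ y, ∑ z, p x * q y * η z * (f x - f y) ^ 2 := by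
    refine sum_congr rfl fun x _ => sum_congr rfl fun y _ => ?_
    have : ∑ z, p x * q y * η z * (f x - f y) ^ 2 = (p x * q y * (f x - f y) ^ 2) * ∑ z, η z := by
      rw [mul_sum]
      exact sum_congr rfl fun z _ => by ring
    rw [this, hη1, mul_one]
  -- pointwise three-point bound, weighted
  have hpt : ∀ x y z, p x * q y * η z * (f x - f y) ^ 2
      ≤ α * (p x * q y * η z * (f x - f z) ^ 2) + β * (p x * q y * η z * (f z - f y) ^ 2) := by
    intro x y z
    have hw : 0 ≤ p x * q y * η z := mul_nonneg (mul_nonneg (hp x) (hq y)) (hη z)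
    have h := hαβ (f x - f z) (f z - f y)
    have heq : f x - f z + (f z - f y) = f x - f y := by ring
    rw [heq] at h
    nlinarith
  -- the two resulting triple sums
  have hA : ∑ x, ∑ y, ∑ z, p x * q y * η z * (f x - f z) ^ 2
      = (∑ y, q y) * ∑ x, ∑ z, p x * η z * (f x - f z) ^ 2 := by
    rw [mul_sum]
    refine sum_congr rfl fun x _ => ?_
    rw [sum_comm, mul_sum]
    refine sum_congr rfl fun z _ => ?_
    rw [sum_mul]
    exact sum_congr rfl fun y _ => by ring
  have hB : ∑ x, ∑ y, ∑ z, p x * q y * η z * (f z - f y) ^ 2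
      = (∑ x, p x) * ∑ z, ∑ y, η z * q y * (f z - f y) ^ 2 := by
    rw [sum_mul]
    refine sum_congr rfl fun x _ => ?_
    rw [sum_comm, mul_sum]
    refine sum_congr rfl fun z _ => ?_
    rw [mul_sum]
    exact sum_congr rfl fun y _ => by ring
  rw [hL]
  calc ∑ x, ∑ y, ∑ z, p x * q y * η z * (f x - f y) ^ 2
      ≤ ∑ x, ∑ y, ∑ z, (α * (p x * q y * η z * (f x - f z) ^ 2)
          + β * (p x * q y * η z * (f z - f y) ^ 2)) :=
        sum_le_sum fun x _ => sum_le_sum fun y _ => sum_le_sum fun z _ => hpt x y z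
    _ = α * ∑ x, ∑ y, ∑ z, p x * q y * η z * (f x - f z) ^ 2
          + β * ∑ x, ∑ y, ∑ z, p x * q y * η z * (f z - f y) ^ 2 := by
        simp_rw [sum_add_distrib, ← mul_sum]
    _ = _ := by rw [hA, hB]; ring

/-! ## The mixture, the edge weights, (41) and (43) -/

omit [Fintype X] [DecidableEq X] in
/-- The mixture density `φ_mix := Σ_{j=0}^{D} a_j φ_j`. [cite: MadrasRandall2002, §1 eq. (10)] -/
def mixture (a : ℕ → ℝ) (φ : ℕ → X → ℝ) (D : ℕ) (x : X) : ℝ :=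
  ∑ j ∈ range (D + 1), a j * φ j x

omit [Fintype X] [DecidableEq X] in
/-- `φ_mix ≥ 0`. [cite: MadrasRandall2002, §1 eq. (10)] -/
theorem mixture_nonneg {a : ℕ → ℝ} {φ : ℕ → X → ℝ} {D : ℕ} (ha : ∀ j ≤ D, 0 ≤ a j)
    (hφ : ∀ j ≤ D, ∀ x, 0 ≤ φ j x) (x : X) : 0 ≤ mixture a φ D x :=
  sum_nonneg fun j hj => mul_nonneg (ha j (Nat.lt_succ_iff.mp (mem_range.mp hj)))
    (hφ j (Nat.lt_succ_iff.mp (mem_range.mp hj)) x)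

omit [DecidableEq X] in
/-- `Σ_x φ_mix(x) = 1` when the weights add up to `1` and each `φ_j` is a probability vector.
[cite: MadrasRandall2002, §1 Theorem 1.2 ("positive numbers that add up to 1")] -/
theorem sum_mixture {a : ℕ → ℝ} {φ : ℕ → X → ℝ} {D : ℕ} (ha1 : ∑ j ∈ range (D + 1), a j = 1)
    (hφ1 : ∀ j ≤ D, ∑ x, φ j x = 1) : ∑ x, mixture a φ D x = 1 := by
  unfold mixture
  rw [sum_comm]
  simp_rw [← mul_sum]
  rw [← ha1]
  exact sum_congr rfl fun j hj => by
    rw [hφ1 j (Nat.lt_succ_iff.mp (mem_range.mp hj)), mul_one]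

omit [Fintype X] [DecidableEq X] in
/-- **Eq. (41), pointwise**: `min` is superadditive, so the edge weights of `R[φ_mix]` dominate the
mixture of the edge weights of the `R[φ_j]` (`a_j ≥ 0`).
[cite: MadrasRandall2002, §5 (the display before eq. (41): "`min{φ_mix(x)/ρ(x), φ_mix(y)/ρ(y)} ≥
Σ_j a_j min{φ_j(x)/ρ(x), φ_j(y)/ρ(y)}`")] -/
theorem mhFlux_mixture_ge {a : ℕ → ℝ} {φ : ℕ → X → ℝ} {D : ℕ} (ha : ∀ j ≤ D, 0 ≤ a j)
    (R : X → X → ℝ) (x y : X) :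
    ∑ j ∈ range (D + 1), a j * mhFlux (φ j) R x y ≤ mhFlux (mixture a φ D) R x y := by
  unfold mhFlux mixture
  rw [sum_mul, sum_mul]
  refine le_min (sum_le_sum fun j hj => ?_) (sum_le_sum fun j hj => ?_)
  · have h := ha j (Nat.lt_succ_iff.mp (mem_range.mp hj))
    calc a j * min (φ j x * R x y) (φ j y * R y x) ≤ a j * (φ j x * R x y) :=
          mul_le_mul_of_nonneg_left (min_le_left _ _) h
      _ = a j * φ j x * R x y := by ring
  · have h := ha j (Nat.lt_succ_iff.mp (mem_range.mp hj))
    calc a j * min (φ j x * R x y) (φ j y * R y x) ≤ a j * (φ j y * R y x) :=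
          mul_le_mul_of_nonneg_left (min_le_right _ _) h
      _ = a j * φ j y * R y x := by ring

/-- The Dirichlet form of `R[φ]` is `½ B_φ`: `𝓔_φ(R[φ]; f) = ½ Σ_{x,y} min{φ(x)R(x,y), φ(y)R(y,x)}
(f(x) − f(y))²` (`φ ≥ 0`, `R ≥ 0`). [cite: MadrasRandall2002, §5 eq. (40) ("the spectral gap of the
Metropolis–Hastings chain for `R` with respect to `φ_j` is given by `Gap_j = inf_f B_j(f)/2V_j(f)`")] -/
theorem dirichletForm_mhKernel {φ : X → ℝ} (hφ : ∀ x, 0 ≤ φ x) {R : X → X → ℝ}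
    (hR : ∀ x y, 0 ≤ R x y) (f : X → ℝ) :
    dirichletForm φ (mhKernel R φ : Matrix X X ℝ) f
      = (1 / 2) * ∑ x, ∑ y, mhFlux φ R x y * (f x - f y) ^ 2 := by
  unfold dirichletForm
  congr 1
  refine sum_congr rfl fun x _ => sum_congr rfl fun y _ => ?_
  by_cases hyx : y = x
  · subst hyx
    simp
  · rw [show (mhKernel R φ : Matrix X X ℝ) x y = mhKernel R φ x y from rfl, mhKernel_of_ne hyx,
      ← mul_mhRate_of_nonneg hφ hR x y]

/-- **Eq. (41)**: `𝓔_mix(f) ≥ Σ_j a_j 𝓔_j(f)` (`B_mix(f) ≥ Σ_j a_j B_j(f)`).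
[cite: MadrasRandall2002, §5 eq. (41)] -/
theorem dirichletForm_mixture_ge {a : ℕ → ℝ} {φ : ℕ → X → ℝ} {D : ℕ} (ha : ∀ j ≤ D, 0 ≤ a j)
    (hφ : ∀ j ≤ D, ∀ x, 0 ≤ φ j x) {R : X → X → ℝ} (hR : ∀ x y, 0 ≤ R x y) (f : X → ℝ) :
    ∑ j ∈ range (D + 1), a j * dirichletForm (φ j) (mhKernel R (φ j) : Matrix X X ℝ) f
      ≤ dirichletForm (mixture a φ D) (mhKernel R (mixture a φ D) : Matrix X X ℝ) f := by
  rw [dirichletForm_mhKernel (mixture_nonneg ha hφ) hR]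
  have h : ∀ j ∈ range (D + 1), a j * dirichletForm (φ j) (mhKernel R (φ j) : Matrix X X ℝ) f
      = (1 / 2) * ∑ x, ∑ y, a j * mhFlux (φ j) R x y * (f x - f y) ^ 2 := by
    intro j hj
    rw [dirichletForm_mhKernel (hφ j (Nat.lt_succ_iff.mp (mem_range.mp hj))) hR, mul_left_comm,
      mul_sum]
    congr 1
    refine sum_congr rfl fun x _ => ?_
    rw [mul_sum]
    exact sum_congr rfl fun y _ => by ring
  rw [sum_congr rfl h, ← mul_sum]
  refine mul_le_mul_of_nonneg_left ?_ (by norm_num)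
  rw [sum_comm]
  refine sum_le_sum fun x _ => ?_
  rw [sum_comm]
  refine sum_le_sum fun y _ => ?_
  rw [← sum_mul]
  exact mul_le_mul_of_nonneg_right (mhFlux_mixture_ge ha R x y) (sq_nonneg _)

omit [DecidableEq X] in
/-- `C` against a finite mixture in the first slot. [cite: MadrasRandall2002, §5 (bilinear
expansion giving `2V_mix(f) = Σ_{i,j} a_i a_j C_{ij}(f)`)] -/
theorem pairForm_mixture_left (a : ℕ → ℝ) (φ : ℕ → X → ℝ) (D : ℕ) (q : X → ℝ) (f : X → ℝ) :
    pairForm (mixture a φ D) q f = ∑ i ∈ range (D + 1), a i * pairForm (φ i) q f := by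
  unfold pairForm mixture
  have h1 : ∀ x y, (∑ j ∈ range (D + 1), a j * φ j x) * q y * (f x - f y) ^ 2
      = ∑ j ∈ range (D + 1), a j * (φ j x * q y * (f x - f y) ^ 2) := by
    intro x y
    rw [sum_mul, sum_mul]
    exact sum_congr rfl fun j _ => by ring
  simp_rw [h1]
  calc ∑ x, ∑ y, ∑ j ∈ range (D + 1), a j * (φ j x * q y * (f x - f y) ^ 2)
      = ∑ x, ∑ j ∈ range (D + 1), ∑ y, a j * (φ j x * q y * (f x - f y) ^ 2) :=
        sum_congr rfl fun x _ => sum_comm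
    _ = ∑ j ∈ range (D + 1), ∑ x, ∑ y, a j * (φ j x * q y * (f x - f y) ^ 2) := sum_comm
    _ = _ := sum_congr rfl fun j _ => by
        rw [mul_sum]
        exact sum_congr rfl fun x _ => by rw [mul_sum]

omit [DecidableEq X] in
/-- `C` against a finite mixture in the second slot. [cite: MadrasRandall2002, §5 (bilinear
expansion giving `2V_mix(f) = Σ_{i,j} a_i a_j C_{ij}(f)`)] -/
theorem pairForm_mixture_right (a : ℕ → ℝ) (φ : ℕ → X → ℝ) (D : ℕ) (p : X → ℝ) (f : X → ℝ) :
    pairForm p (mixture a φ D) f = ∑ j ∈ range (D + 1), a j * pairForm p (φ j) f := by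
  rw [pairForm_comm, pairForm_mixture_left]
  exact sum_congr rfl fun j _ => by rw [pairForm_comm]

omit [DecidableEq X] in
/-- **Eq. (43), exact form**: `2V_mix(f) = Σ_{i,j} a_i a_j C_{ij}(f)`.
[cite: MadrasRandall2002, §5 (the display before eq. (43))] -/
theorem two_mul_lawVariance_mixture {a : ℕ → ℝ} {φ : ℕ → X → ℝ} {D : ℕ}
    (ha1 : ∑ j ∈ range (D + 1), a j = 1) (hφ1 : ∀ j ≤ D, ∑ x, φ j x = 1) (f : X → ℝ) :
    2 * lawVariance (mixture a φ D) f
      = ∑ i ∈ range (D + 1), ∑ j ∈ range (D + 1), a i * a j * pairForm (φ i) (φ j) f := by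
  rw [← pairForm_self (sum_mixture ha1 hφ1), pairForm_mixture_left]
  refine sum_congr rfl fun i _ => ?_
  rw [pairForm_mixture_right, mul_sum]
  exact sum_congr rfl fun j _ => by ring

/-! ## Eqs. (44)–(47): the overlap bound for neighbours -/

omit [DecidableEq X] in
/-- **Eq. (47) (division-free form)**: if `Σ_x min{p(x), q(x)} ≥ δ > 0` for probability vectors
`p, q`, then **`δ C(p,q)(f) ≤ (2 − δ)(V_p(f) + V_q(f))`**.  Proof as in the paper with the common part
`η := min{p,q}/Σ min` and the decompositions `p = δη + r_p`, `q = δη + r_q` (eq. (44):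
`2V_p = δ²C(η,η) + 2δC(η,r_p) + C(r_p,r_p)`, whence (46); eq. (45) and the three-point inequality with
`(u+v)² ≤ 2u² + 2v²` for `C(r_p, r_q)`). [cite: MadrasRandall2002, §5 eqs. (44)–(47)] -/
theorem pairForm_le_of_overlap {p q : X → ℝ} (hp : ∀ x, 0 ≤ p x) (hq : ∀ x, 0 ≤ q x)
    (hp1 : ∑ x, p x = 1) (hq1 : ∑ x, q x = 1) {δ : ℝ} (hδ : 0 < δ)
    (hover : δ ≤ ∑ x, min (p x) (q x)) (f : X → ℝ) :
    δ * pairForm p q f ≤ (2 - δ) * (lawVariance p f + lawVariance q f) := by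
  set s := ∑ x, min (p x) (q x) with hs
  have hspos : 0 < s := lt_of_lt_of_le hδ hover
  have hs1 : s ≤ 1 := by
    rw [hs, ← hp1]
    exact sum_le_sum fun x _ => min_le_left _ _
  have hδ1 : δ ≤ 1 := hover.trans hs1
  -- the common part `η` and the remainders
  set η : X → ℝ := fun x => min (p x) (q x) / s with hη
  set rp : X → ℝ := fun x => p x - δ * η x with hrp
  set rq : X → ℝ := fun x => q x - δ * η x with hrq
  have hη0 : ∀ x, 0 ≤ η x := fun x => div_nonneg (le_min (hp x) (hq x)) hspos.le
  have hη1 : ∑ x, η x = 1 := by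
    simp only [hη]
    rw [← sum_div, ← hs, div_self hspos.ne']
  have hδη : ∀ x, δ * η x ≤ min (p x) (q x) := fun x => by
    simp only [hη]
    rw [mul_div_assoc']
    calc δ * min (p x) (q x) / s ≤ s * min (p x) (q x) / s :=
          div_le_div_of_nonneg_right (mul_le_mul_of_nonneg_right hover (le_min (hp x) (hq x)))
            hspos.le
      _ = min (p x) (q x) := by rw [mul_comm, mul_div_assoc, div_self hspos.ne', mul_one]
  have hrp0 : ∀ x, 0 ≤ rp x := fun x => by
    simp only [hrp]
    linarith [hδη x, min_le_left (p x) (q x)]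
  have hrq0 : ∀ x, 0 ≤ rq x := fun x => by
    simp only [hrq]
    linarith [hδη x, min_le_right (p x) (q x)]
  have hrp1 : ∑ x, rp x = 1 - δ := by
    simp only [hrp]
    rw [sum_sub_distrib, hp1, ← mul_sum, hη1, mul_one]
  have hrq1 : ∑ x, rq x = 1 - δ := by
    simp only [hrq]
    rw [sum_sub_distrib, hq1, ← mul_sum, hη1, mul_one]
  have hpdec : p = fun x => δ * η x + rp x := by
    funext x; simp only [hrp]; ring
  have hqdec : q = fun x => δ * η x + rq x := by
    funext x; simp only [hrq]; ring
  -- abbreviations for the forms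
  set Cee := pairForm η η f with hCee
  set Cep := pairForm η rp f with hCep
  set Ceq := pairForm η rq f with hCeq
  set Cpp := pairForm rp rp f with hCpp
  set Cpq := pairForm rp rq f with hCpq
  have hCee0 : 0 ≤ Cee := pairForm_nonneg hη0 hη0 f
  have hCpp0 : 0 ≤ Cpp := pairForm_nonneg hrp0 hrp0 f
  have hCep0 : 0 ≤ Cep := pairForm_nonneg hη0 hrp0 f
  have hCeq0 : 0 ≤ Ceq := pairForm_nonneg hη0 hrq0 f
  -- eq. (44): `2V_p = δ²C(η,η) + 2δC(η,r_p) + C(r_p,r_p)`, and the same for `q`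
  have h44p : 2 * lawVariance p f = δ ^ 2 * Cee + 2 * δ * Cep + Cpp := by
    rw [← pairForm_self hp1, hpdec, pairForm_add_left, pairForm_smul_left, pairForm_add_right,
      pairForm_smul_right, pairForm_add_right, pairForm_smul_right, pairForm_comm rp η]
    ring
  have h44q : 2 * lawVariance q f = δ ^ 2 * Cee + 2 * δ * Ceq + pairForm rq rq f := by
    rw [← pairForm_self hq1, hqdec, pairForm_add_left, pairForm_smul_left, pairForm_add_right,
      pairForm_smul_right, pairForm_add_right, pairForm_smul_right, pairForm_comm rq η]
    ring
  have hCqq0 : 0 ≤ pairForm rq rq f := pairForm_nonneg hrq0 hrq0 f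
  -- eq. (45): `C(p,q) = δ²C(η,η) + δC(η,r_q) + δC(r_p,η) + C(r_p,r_q)`
  have h45 : pairForm p q f = δ ^ 2 * Cee + δ * Ceq + δ * Cep + Cpq := by
    rw [hpdec, hqdec, pairForm_add_left, pairForm_smul_left, pairForm_add_right,
      pairForm_smul_right, pairForm_add_right, pairForm_smul_right, pairForm_comm rp η]
    ring
  -- three-point bound for the remainders through `η`: `C(r_p,r_q) ≤ 2(1−δ)(C(η,r_p) + C(η,r_q))`
  have h3 : Cpq ≤ 2 * (1 - δ) * Cep + 2 * (1 - δ) * Ceq := by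
    have h := pairForm_three_point hrp0 hrq0 hη0 hη1 (α := 2) (β := 2)
      (fun u v => by nlinarith [sq_nonneg (u - v)]) f
    rw [hrq1, hrp1, pairForm_comm rp η] at h
    linarith
  -- assemble (46)–(47): `2δ C(p,q) ≤ 4δ²(δ−1)C(η,η) + 2(2−δ)(V_p+V_q) ≤ 2(2−δ)(V_p+V_q)`
  have hδ0 : 0 ≤ δ := hδ.le
  nlinarith [mul_nonneg (mul_nonneg (sq_nonneg δ) (by linarith : 0 ≤ 1 - δ)) hCee0,
    mul_nonneg hδ0 hCpp0, mul_nonneg hδ0 hCqq0, mul_nonneg hδ0 hCep0, mul_nonneg hδ0 hCeq0,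
    mul_nonneg (by linarith : 0 ≤ 2 - δ) hCpp0]

/-! ## Eq. (48): the path bound -/

omit [DecidableEq X] in
/-- The weighted triangle inequality `n C(p,q) ≤ (n+1) C(p,η) + n(n+1) C(η,q)` for probability vectors
(the Schwarz step of eq. (48), one edge at a time). [cite: MadrasRandall2002, §5 eq. (48) ("where we
used the Schwarz inequality in the third line")] -/
theorem pairForm_triangle {p q η : X → ℝ} (hp : ∀ x, 0 ≤ p x) (hq : ∀ x, 0 ≤ q x)
    (hη : ∀ x, 0 ≤ η x) (hp1 : ∑ x, p x = 1) (hq1 : ∑ x, q x = 1) (hη1 : ∑ x, η x = 1)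
    {n : ℝ} (hn : 0 < n) (f : X → ℝ) :
    n * pairForm p q f ≤ (n + 1) * pairForm p η f + n * (n + 1) * pairForm η q f := by
  have h := pairForm_three_point hp hq hη hη1 (α := (n + 1) / n) (β := n + 1) (fun u v => by
    have hexp : (n + 1) / n * u ^ 2 + (n + 1) * v ^ 2 - (u + v) ^ 2 = (u - n * v) ^ 2 / n := by
      field_simp
      ring
    have hnn : 0 ≤ (u - n * v) ^ 2 / n := div_nonneg (sq_nonneg _) hn.le
    linarith) f
  rw [hq1, hp1, mul_one, mul_one] at h
  have := mul_le_mul_of_nonneg_left h hn.le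
  have heq : n * ((n + 1) / n * pairForm p η f + (n + 1) * pairForm η q f)
      = (n + 1) * pairForm p η f + n * (n + 1) * pairForm η q f := by
    rw [mul_add, ← mul_assoc, mul_div_cancel₀ _ hn.ne']
    ring
  rw [heq] at this
  exact this

omit [DecidableEq X] in
/-- **Eq. (48), first inequality**: along the path `i, i+1, …, i+n` of densities,
`C_{i,i+n}(f) ≤ n Σ_{k<n} C_{i+k,i+k+1}(f)`. [cite: MadrasRandall2002, §5 eq. (48) (first line)] -/
theorem pairForm_le_path {φ : ℕ → X → ℝ} (hφ : ∀ j, ∀ x, 0 ≤ φ j x) (hφ1 : ∀ j, ∑ x, φ j x = 1)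
    (f : X → ℝ) (i : ℕ) :
    ∀ n : ℕ, pairForm (φ i) (φ (i + (n + 1))) f
      ≤ (n + 1) * ∑ k ∈ range (n + 1), pairForm (φ (i + k)) (φ (i + k + 1)) f := by
  intro n
  induction n with
  | zero => simp
  | succ n ih =>
    have htri := pairForm_triangle (hφ i) (hφ (i + (n + 1 + 1))) (hφ (i + (n + 1))) (hφ1 _) (hφ1 _)
      (hφ1 _) (n := (n : ℝ) + 1) (by positivity) f
    rw [sum_range_succ]
    have hcast : ((n + 1 : ℕ) : ℝ) + 1 = (n : ℝ) + 1 + 1 := by push_cast; ring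
    rw [hcast]
    have hlast : φ (i + (n + 1) + 1) = φ (i + (n + 1 + 1)) := by rw [Nat.add_assoc]
    rw [hlast]
    have hS0 : 0 ≤ ∑ k ∈ range (n + 1), pairForm (φ (i + k)) (φ (i + k + 1)) f :=
      sum_nonneg fun k _ => pairForm_nonneg (hφ _) (hφ _) f
    have h0 : 0 ≤ pairForm (φ (i + (n + 1))) (φ (i + (n + 1 + 1))) f := pairForm_nonneg (hφ _) (hφ _) f
    -- `(n+1) C_{i,i+n+2} ≤ (n+2) C_{i,i+n+1} + (n+1)(n+2) c`, and `C_{i,i+n+1} ≤ (n+1) S`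
    nlinarith [ih, htri, mul_le_mul_of_nonneg_left ih (by positivity : (0 : ℝ) ≤ (n : ℝ) + 1 + 1)]

/-! ## Eq. (42) and Theorem 1.2 -/

omit [DecidableEq X] in
/-- A path sum starting inside `{0,…,D}` is at most the full sum of the (non-negative) neighbour forms:
`Σ_{k<n} C_{i+k,i+k+1} ≤ Σ_{k<D} C_{k,k+1}` for `i + n ≤ D`. [cite: MadrasRandall2002, §5 eq. (48)
(second inequality, "`≤ D Σ_{k=0}^{D−1} C_{k,k+1}(f)`")] -/
theorem sum_path_le_sum_range {φ : ℕ → X → ℝ} (hφ : ∀ j, ∀ x, 0 ≤ φ j x) (f : X → ℝ) {i n D : ℕ}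
    (h : i + n ≤ D) :
    ∑ k ∈ range n, pairForm (φ (i + k)) (φ (i + k + 1)) f
      ≤ ∑ k ∈ range D, pairForm (φ k) (φ (k + 1)) f := by
  have h1 : ∑ k ∈ range n, pairForm (φ (i + k)) (φ (i + k + 1)) f
      = ∑ k ∈ Ico i (i + n), pairForm (φ k) (φ (k + 1)) f := by
    rw [sum_Ico_eq_sum_range, Nat.add_sub_cancel_left]
  rw [h1, ← Nat.Ico_zero_eq_range]
  exact sum_le_sum_of_subset_of_nonneg (Ico_subset_Ico (Nat.zero_le _) h)
    fun k _ _ => pairForm_nonneg (hφ _) (hφ _) f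

omit [DecidableEq X] in
/-- **Eq. (48)**: under the overlap hypothesis (11), every `C_{ij}(f)`, `i, j ≤ D`, `D ≥ 1`, is at most
`(2(2−δ)D/δ) Σ_{l ≤ D} V_l(f)` (division-free: `δ C_{ij} ≤ 2(2−δ)D Σ_l V_l`).
[cite: MadrasRandall2002, §5 eq. (48) with (47) ("Notice that the last expression in (48) is also a
bound for the case `i = j`, because `C_{jj}(f) = 2V_j(f)`")] -/
theorem pairForm_le_sum_lawVariance {φ : ℕ → X → ℝ} (hφ : ∀ j, ∀ x, 0 ≤ φ j x)
    (hφ1 : ∀ j, ∑ x, φ j x = 1) {D : ℕ} (hD : 1 ≤ D) {δ : ℝ} (hδ : 0 < δ)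
    (hover : ∀ j < D, δ ≤ ∑ x, min (φ j x) (φ (j + 1) x)) (f : X → ℝ) {i j : ℕ} (hi : i ≤ D)
    (hj : j ≤ D) :
    δ * pairForm (φ i) (φ j) f ≤ 2 * (2 - δ) * D * ∑ l ∈ range (D + 1), lawVariance (φ l) f := by
  -- the neighbour bound (47) summed along the whole path
  have hV0 : ∀ l, 0 ≤ lawVariance (φ l) f := fun l => lawVariance_nonneg (hφ l) f
  have hδ1 : δ ≤ 1 := by
    have h := hover 0 hD
    calc δ ≤ ∑ x, min (φ 0 x) (φ 1 x) := h
      _ ≤ ∑ x, φ 0 x := sum_le_sum fun x _ => min_le_left _ _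
      _ = 1 := hφ1 0
  have hpath : δ * ∑ k ∈ range D, pairForm (φ k) (φ (k + 1)) f
      ≤ (2 - δ) * (2 * ∑ l ∈ range (D + 1), lawVariance (φ l) f) := by
    rw [mul_sum]
    calc ∑ k ∈ range D, δ * pairForm (φ k) (φ (k + 1)) f
        ≤ ∑ k ∈ range D, (2 - δ) * (lawVariance (φ k) f + lawVariance (φ (k + 1)) f) :=
          sum_le_sum fun k hk => pairForm_le_of_overlap (hφ k) (hφ (k + 1)) (hφ1 k) (hφ1 (k + 1))
            hδ (hover k (mem_range.mp hk)) f
      _ = (2 - δ) * (∑ k ∈ range D, lawVariance (φ k) f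
            + ∑ k ∈ range D, lawVariance (φ (k + 1)) f) := by
          rw [← mul_sum, sum_add_distrib]
      _ ≤ (2 - δ) * (2 * ∑ l ∈ range (D + 1), lawVariance (φ l) f) := by
          refine mul_le_mul_of_nonneg_left ?_ (by linarith)
          have h1 : ∑ k ∈ range D, lawVariance (φ k) f ≤ ∑ l ∈ range (D + 1), lawVariance (φ l) f := by
            rw [sum_range_succ]
            linarith [hV0 D]
          have h2 : ∑ k ∈ range D, lawVariance (φ (k + 1)) f
              ≤ ∑ l ∈ range (D + 1), lawVariance (φ l) f := by
            rw [sum_range_succ']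
            linarith [hV0 0]
          linarith
  have hS0 : 0 ≤ ∑ l ∈ range (D + 1), lawVariance (φ l) f := sum_nonneg fun l _ => hV0 l
  have hP0 : 0 ≤ ∑ k ∈ range D, pairForm (φ k) (φ (k + 1)) f :=
    sum_nonneg fun k _ => pairForm_nonneg (hφ _) (hφ _) f
  have hDr : (1 : ℝ) ≤ D := by exact_mod_cast hD
  -- the three cases `i < j`, `i = j`, `i > j`
  have hlt : ∀ i j, i ≤ D → j ≤ D → i < j →
      δ * pairForm (φ i) (φ j) f ≤ 2 * (2 - δ) * D * ∑ l ∈ range (D + 1), lawVariance (φ l) f := by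
    intro i j hi hj hij
    obtain ⟨n, rfl⟩ : ∃ n, j = i + (n + 1) := ⟨j - i - 1, by omega⟩
    have hp := pairForm_le_path hφ hφ1 f i n
    have hsub := sum_path_le_sum_range hφ f (i := i) (n := n + 1) (D := D) (by omega)
    have hn1 : ((n : ℝ) + 1) ≤ D := by
      have : n + 1 ≤ D := by omega
      exact_mod_cast this
    have hpn0 : 0 ≤ ∑ k ∈ range (n + 1), pairForm (φ (i + k)) (φ (i + k + 1)) f :=
      sum_nonneg fun k _ => pairForm_nonneg (hφ _) (hφ _) f
    -- δ C_{ij} ≤ δ (n+1) Σ_path ≤ δ D Σ_{k<D} C_{k,k+1} ≤ D (2−δ) 2 ΣV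
    calc δ * pairForm (φ i) (φ (i + (n + 1))) f
        ≤ δ * ((n + 1) * ∑ k ∈ range (n + 1), pairForm (φ (i + k)) (φ (i + k + 1)) f) :=
          mul_le_mul_of_nonneg_left hp hδ.le
      _ ≤ δ * (D * ∑ k ∈ range D, pairForm (φ k) (φ (k + 1)) f) := by
          refine mul_le_mul_of_nonneg_left ?_ hδ.le
          exact mul_le_mul hn1 hsub hpn0 (by linarith)
      _ = D * (δ * ∑ k ∈ range D, pairForm (φ k) (φ (k + 1)) f) := by ring
      _ ≤ D * ((2 - δ) * (2 * ∑ l ∈ range (D + 1), lawVariance (φ l) f)) :=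
          mul_le_mul_of_nonneg_left hpath (by linarith)
      _ = 2 * (2 - δ) * D * ∑ l ∈ range (D + 1), lawVariance (φ l) f := by ring
  rcases lt_trichotomy i j with hij | rfl | hji
  · exact hlt i j hi hj hij
  · -- `C_{ii} = 2V_i ≤ 2 ΣV ≤ (2(2−δ)D/δ) ΣV`
    rw [pairForm_self (hφ1 i)]
    have hVi : lawVariance (φ i) f ≤ ∑ l ∈ range (D + 1), lawVariance (φ l) f :=
      single_le_sum (fun l _ => hV0 l) (mem_range.mpr (Nat.lt_succ_of_le hi))
    have h1 : (1 : ℝ) ≤ (2 - δ) * D := by nlinarith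
    have h2 : ∑ l ∈ range (D + 1), lawVariance (φ l) f
        ≤ (2 - δ) * D * ∑ l ∈ range (D + 1), lawVariance (φ l) f := le_mul_of_one_le_left hS0 h1
    have h3 : δ * lawVariance (φ i) f ≤ lawVariance (φ i) f := mul_le_of_le_one_left (hV0 i) hδ1
    linarith
  · rw [pairForm_comm]
    exact hlt j i hj hi hji

omit [DecidableEq X] in
/-- **Eq. (42)**: `2V_mix(f) ≤ (2(2−δ)D/δ) Σ_{l ≤ D} V_l(f) (≤ (4D/δ) Σ_l V_l(f))`, division-free.
[cite: MadrasRandall2002, §5 eqs. (42)–(43), (48)] -/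
theorem two_mul_lawVariance_mixture_le {a : ℕ → ℝ} {φ : ℕ → X → ℝ} {D : ℕ}
    (ha : ∀ j ≤ D, 0 ≤ a j) (ha1 : ∑ j ∈ range (D + 1), a j = 1) (hφ : ∀ j, ∀ x, 0 ≤ φ j x)
    (hφ1 : ∀ j, ∑ x, φ j x = 1) (hD : 1 ≤ D) {δ : ℝ} (hδ : 0 < δ)
    (hover : ∀ j < D, δ ≤ ∑ x, min (φ j x) (φ (j + 1) x)) (f : X → ℝ) :
    δ * (2 * lawVariance (mixture a φ D) f)
      ≤ 2 * (2 - δ) * D * ∑ l ∈ range (D + 1), lawVariance (φ l) f := by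
  set K := 2 * (2 - δ) * D * ∑ l ∈ range (D + 1), lawVariance (φ l) f with hK
  rw [two_mul_lawVariance_mixture ha1 (fun j _ => hφ1 j), mul_sum]
  calc ∑ i ∈ range (D + 1), δ * ∑ j ∈ range (D + 1), a i * a j * pairForm (φ i) (φ j) f
      ≤ ∑ i ∈ range (D + 1), ∑ j ∈ range (D + 1), a i * a j * K := by
        refine sum_le_sum fun i hi => ?_
        rw [mul_sum]
        refine sum_le_sum fun j hj => ?_
        have hi' := Nat.lt_succ_iff.mp (mem_range.mp hi)
        have hj' := Nat.lt_succ_iff.mp (mem_range.mp hj)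
        have h := pairForm_le_sum_lawVariance hφ hφ1 hD hδ hover f hi' hj'
        have haa : 0 ≤ a i * a j := mul_nonneg (ha i hi') (ha j hj')
        calc δ * (a i * a j * pairForm (φ i) (φ j) f) = a i * a j * (δ * pairForm (φ i) (φ j) f) := by
              ring
          _ ≤ a i * a j * K := mul_le_mul_of_nonneg_left h haa
    _ = (∑ i ∈ range (D + 1), a i) * (∑ j ∈ range (D + 1), a j) * K := by
        rw [sum_mul, sum_mul]
        refine sum_congr rfl fun i _ => ?_
        rw [mul_sum, sum_mul]
    _ = K := by rw [ha1]; ring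

/-- **THEOREM 1.2 (Density Decomposition Theorem), Poincaré form.**  Let `φ_0, …, φ_D` (`D ≥ 1`) be
probability vectors on `Ω`, `a_0, …, a_D ≥ 0` weights adding up to `1`, `φ_mix = Σ a_j φ_j`, `R ≥ 0` any
proposal matrix, and suppose neighbouring densities overlap: `Σ_x min{φ_j(x), φ_{j+1}(x)} ≥ δ > 0`
(`j < D`).  If each Metropolis–Hastings chain `R[φ_j]` satisfies `𝓔_j(f) ≥ λ_j V_j(f)` and
`0 ≤ m ≤ a_j λ_j` for all `j`, then **`𝓔_mix(f) ≥ (δ/(2D))·m·V_mix(f)`** for every `f`.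
[cite: MadrasRandall2002, §1 Theorem 1.2; §5 (proof, eqs. (40)–(48))] -/
theorem MadrasRandall2002_thm_1_2 {a : ℕ → ℝ} {φ : ℕ → X → ℝ} {D : ℕ} (ha : ∀ j ≤ D, 0 ≤ a j)
    (ha1 : ∑ j ∈ range (D + 1), a j = 1) (hφ : ∀ j, ∀ x, 0 ≤ φ j x) (hφ1 : ∀ j, ∑ x, φ j x = 1)
    (hD : 1 ≤ D) {R : X → X → ℝ} (hR : ∀ x y, 0 ≤ R x y) {δ : ℝ} (hδ : 0 < δ)
    (hover : ∀ j < D, δ ≤ ∑ x, min (φ j x) (φ (j + 1) x)) {lam : ℕ → ℝ} {m : ℝ} (hm0 : 0 ≤ m)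
    (hm : ∀ j ≤ D, m ≤ a j * lam j)
    (hgap : ∀ j ≤ D, ∀ f : X → ℝ, lam j * lawVariance (φ j) f
      ≤ dirichletForm (φ j) (mhKernel R (φ j) : Matrix X X ℝ) f) (f : X → ℝ) :
    δ / (2 * D) * m * lawVariance (mixture a φ D) f
      ≤ dirichletForm (mixture a φ D) (mhKernel R (mixture a φ D) : Matrix X X ℝ) f := by
  have hDpos : (0 : ℝ) < D := by exact_mod_cast hD
  have hV0 : ∀ l, 0 ≤ lawVariance (φ l) f := fun l => lawVariance_nonneg (hφ l) f
  set S := ∑ l ∈ range (D + 1), lawVariance (φ l) f with hS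
  -- (41): 𝓔_mix ≥ Σ a_j 𝓔_j ≥ Σ a_j λ_j V_j ≥ m Σ V_j
  have h41 := dirichletForm_mixture_ge ha (fun j _ => hφ j) hR f (a := a) (φ := φ) (D := D)
  have hsum : m * S ≤ ∑ j ∈ range (D + 1), a j * dirichletForm (φ j) (mhKernel R (φ j) : Matrix X X ℝ) f := by
    rw [hS, mul_sum]
    refine sum_le_sum fun j hj => ?_
    have hj' := Nat.lt_succ_iff.mp (mem_range.mp hj)
    calc m * lawVariance (φ j) f ≤ a j * lam j * lawVariance (φ j) f :=
          mul_le_mul_of_nonneg_right (hm j hj') (hV0 j)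
      _ = a j * (lam j * lawVariance (φ j) f) := by ring
      _ ≤ a j * dirichletForm (φ j) (mhKernel R (φ j) : Matrix X X ℝ) f :=
          mul_le_mul_of_nonneg_left (hgap j hj' f) (ha j hj')
  -- (42): δ · 2V_mix ≤ 2(2−δ)D S ≤ 4 D S
  have h42 := two_mul_lawVariance_mixture_le ha ha1 hφ hφ1 hD hδ hover f
  have hVmix0 : 0 ≤ lawVariance (mixture a φ D) f :=
    lawVariance_nonneg (mixture_nonneg ha fun j _ => hφ j) f
  have hS0 : 0 ≤ S := sum_nonneg fun l _ => hV0 l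
  have h42' : δ * lawVariance (mixture a φ D) f ≤ 2 * D * S := by
    have hprod : 0 ≤ δ * (D * S) := mul_nonneg hδ.le (mul_nonneg hDpos.le hS0)
    rw [← hS] at h42
    linarith
  -- combine
  calc δ / (2 * D) * m * lawVariance (mixture a φ D) f
      = m * (δ * lawVariance (mixture a φ D) f) / (2 * D) := by ring
    _ ≤ m * (2 * D * S) / (2 * D) := by
        refine div_le_div_of_nonneg_right (mul_le_mul_of_nonneg_left h42' hm0) (by linarith)
    _ = m * S := by field_simp
    _ ≤ _ := hsum.trans h41

omit [Fintype X] [DecidableEq X] in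
/-- The Metropolis–Hastings rate is non-negative for `φ ≥ 0`, `R ≥ 0` (zero denominators give `0`).
[cite: MadrasRandall2002, §1 eq. (9) (zero-denominator convention)] -/
theorem mhRate_nonneg_of_nonneg {φ : X → ℝ} (hφ : ∀ x, 0 ≤ φ x) {R : X → X → ℝ}
    (hR : ∀ x y, 0 ≤ R x y) (x y : X) : 0 ≤ mhRate R φ x y :=
  le_min (hR x y) (div_nonneg (mul_nonneg (hφ y) (hR y x)) (hφ x))

/-- The Metropolis–Hastings kernel is entrywise non-negative for `φ ≥ 0` and a proposal `R ≥ 0` with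
row sums `≤ 1`. [cite: MadrasRandall2002, §1 eq. (9)] -/
theorem mhKernel_nonneg_of_nonneg {φ : X → ℝ} (hφ : ∀ x, 0 ≤ φ x) {R : X → X → ℝ}
    (hR : ∀ x y, 0 ≤ R x y) (hRrow : ∀ x, ∑ y, R x y ≤ 1) (x y : X) : 0 ≤ mhKernel R φ x y := by
  by_cases h : y = x
  · subst h
    rw [mhKernel_self, sub_nonneg]
    calc ∑ z ∈ univ.erase y, mhRate R φ y z ≤ ∑ z ∈ univ.erase y, R y z :=
          sum_le_sum fun z _ => mhRate_le R φ y z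
      _ ≤ ∑ z, R y z := sum_le_sum_of_subset_of_nonneg (erase_subset _ _) fun z _ _ => hR y z
      _ ≤ 1 := hRrow y
  · rw [mhKernel_of_ne h]
    exact mhRate_nonneg_of_nonneg hφ hR x y

/-- **THEOREM 1.2 (Density Decomposition Theorem) as printed**: with `Gap_j` the (variational)
spectral gap of the Metropolis–Hastings chain `R[φ_j]` and `Gap_mix` that of `R[φ_mix]`, under the
overlap hypothesis (11), **`Gap_mix ≥ (δ/(2D)) min_{j=0,…,D} a_j Gap_j`** — here for any proposal
matrix `R ≥ 0` with row sums `≤ 1`, weights `a_j ≥ 0` adding up to `1`, probability vectors `φ_j`,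
and `φ_mix` not a point mass (some set has `φ_mix`-mass in `(0, ½]`, as in the tree's Theorem 13.10,
so that the variational gap of `R[φ_mix]` is a genuine infimum).
[cite: MadrasRandall2002, §1 Theorem 1.2, eq. (12)] -/
theorem MadrasRandall2002_thm_1_2_spectralGapR {a : ℕ → ℝ} {φ : ℕ → X → ℝ} {D : ℕ}
    (ha : ∀ j ≤ D, 0 ≤ a j) (ha1 : ∑ j ∈ range (D + 1), a j = 1) (hφ : ∀ j, ∀ x, 0 ≤ φ j x)
    (hφ1 : ∀ j, ∑ x, φ j x = 1) (hD : 1 ≤ D) {R : X → X → ℝ} (hR : ∀ x y, 0 ≤ R x y)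
    (hRrow : ∀ x, ∑ y, R x y ≤ 1) {δ : ℝ} (hδ : 0 < δ)
    (hover : ∀ j < D, δ ≤ ∑ x, min (φ j x) (φ (j + 1) x))
    (hX : ∃ S : Finset X, 0 < ∑ x ∈ S, mixture a φ D x ∧ ∑ x ∈ S, mixture a φ D x ≤ 1 / 2) :
    δ / (2 * D) * (range (D + 1)).inf' (nonempty_range_iff.mpr (Nat.succ_ne_zero D))
        (fun j => a j * spectralGapR (φ j) (mhKernel R (φ j) : Matrix X X ℝ))
      ≤ spectralGapR (mixture a φ D) (mhKernel R (mixture a φ D) : Matrix X X ℝ) := by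
  set m := (range (D + 1)).inf' (nonempty_range_iff.mpr (Nat.succ_ne_zero D))
    (fun j => a j * spectralGapR (φ j) (mhKernel R (φ j) : Matrix X X ℝ)) with hm
  have hMH0 : ∀ j, ∀ x y, 0 ≤ (mhKernel R (φ j) : Matrix X X ℝ) x y := fun j x y =>
    mhKernel_nonneg_of_nonneg (hφ j) hR hRrow x y
  have hm0 : 0 ≤ m :=
    (le_inf'_iff _ _).mpr fun j hj => mul_nonneg (ha j (Nat.lt_succ_iff.mp (mem_range.mp hj)))
      (spectralGapR_nonneg (hφ j) (hMH0 j))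
  have hmle : ∀ j ≤ D, m ≤ a j * spectralGapR (φ j) (mhKernel R (φ j) : Matrix X X ℝ) := fun j hj =>
    inf'_le _ (mem_range.mpr (Nat.lt_succ_of_le hj))
  -- the mixture chain: constraint set nonempty unless `Var ≡ 0`; use the test-function route
  have hmix0 : ∀ x, 0 ≤ mixture a φ D x := mixture_nonneg ha fun j _ => hφ j
  have hmix1 : ∑ x, mixture a φ D x = 1 := sum_mixture ha1 fun j _ => hφ1 j
  have hP : ∀ f : X → ℝ, δ / (2 * D) * m * lawVariance (mixture a φ D) f
      ≤ dirichletForm (mixture a φ D) (mhKernel R (mixture a φ D) : Matrix X X ℝ) f := fun f =>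
    MadrasRandall2002_thm_1_2 ha ha1 hφ hφ1 hD hR hδ hover hm0 hmle
      (fun j _ g => by
        -- the variational gap is a Poincaré constant (the tree's Remark 13.8 in product form; the
        -- same four lines as `Decomposition.spectralGapR_mul_lawVariance_le`)
        rcases (lawVariance_nonneg (hφ j) g).eq_or_lt with hV | hV
        · rw [← hV, mul_zero]
          exact dirichletForm_nonneg (hφ j) (hMH0 j) g
        · exact (le_div_iff₀ hV).mp
            (spectralGapR_le_dirichletForm_div_lawVariance (hφ j) (hφ1 j) (hMH0 j) hV)) f
  -- a Poincaré inequality with constant `c` gives `c ≤ Gap_R` once the constraint set is nonempty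
  obtain ⟨g, hg0, hg1⟩ := exists_mean_zero_piInner_one hmix1 hX
  refine le_csInf ⟨_, ⟨g, ⟨hg0, hg1⟩, rfl⟩⟩ ?_
  rintro _ ⟨f, ⟨hf0, hf1⟩, rfl⟩
  have hvar : lawVariance (mixture a φ D) f = 1 := by
    have hmean : lawMean (mixture a φ D) f = 0 := hf0
    unfold lawVariance
    rw [hmean]
    unfold piInner at hf1
    rw [← hf1]
    exact sum_congr rfl fun x _ => by ring
  have h := hP f
  rw [hvar, mul_one] at h
  exact h

end Literature.Probability.MarkovChains.DensityDecomposition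

/-! # Second block: the Remark after the proof (overlap graph of diameter `M`), the printed gap
# bound without a non-degeneracy hypothesis, and Lemma 3.1 (Madras–Piccioni: comparable densities)

[cite: MadrasRandall2002, §5 Remark ("Theorem 1.2 can be generalized to the case that the overlapping
`φ_j`'s are not linearly arranged … consider a graph whose vertices are `0, 1, …, D`, with an edge
joining `i` to `j` if and only if `∫ min{φ_i, φ_j} dλ ≥ δ`.  Let `M` be the diameter of this graph …
Then `Gap_mix ≥ (δ/2M) min_j a_j Gap_j`.")]  The path bound (48) is run along a path with distinct
vertices (a shortest path), so that `Σ_{edges}(V_{v_k} + V_{v_{k+1}}) ≤ 2 Σ_l V_l` still holds; and the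
point-mass case of `φ_mix` (empty constraint set, `Gap = sInf ∅ = 0` on both sides) is settled, so that
Theorem 1.2 holds exactly as printed (`MadrasRandall2002_thm_1_2_spectralGapR'`).  Finally §3 LEMMA 3.1
[cite: MadrasRandall2002, §3 Lemma 3.1]: `a ≤ r₁/r₂ ≤ b ⇒ (a/b)Gap(R[r₂]) ≤ Gap(R[r₁]) ≤ (b/a)Gap(R[r₂])`
(`MadrasRandall2002_lemma_3_1`; used in the paper for eq. (31), the umbrella chain `P[κ]` versus `P`). -/

namespace Literature.Probability.MarkovChains.DensityDecomposition

open Finset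

variable {X : Type*} [Fintype X] [DecidableEq X]

omit [DecidableEq X] in
/-- A sum of non-negative terms along DISTINCT indices inside `{0,…,D}` is at most the full sum.
[cite: MadrasRandall2002, §5 Remark (the final paragraph of the proof run along a path of the
overlap graph)] -/
theorem sum_comp_le_sum_range {V : ℕ → ℝ} (hV : ∀ l, 0 ≤ V l) {D n : ℕ} {v : ℕ → ℕ}
    (hvD : ∀ k < n, v k ≤ D) (hinj : ∀ k < n, ∀ l < n, v k = v l → k = l) :
    ∑ k ∈ range n, V (v k) ≤ ∑ l ∈ range (D + 1), V l := by
  have hinj' : ∀ k ∈ range n, ∀ l ∈ range n, v k = v l → k = l := fun k hk l hl h =>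
    hinj k (mem_range.mp hk) l (mem_range.mp hl) h
  rw [← sum_image hinj']
  refine sum_le_sum_of_subset_of_nonneg (fun l hl => ?_) fun l _ _ => hV l
  obtain ⟨k, hk, rfl⟩ := mem_image.mp hl
  exact mem_range.mpr (Nat.lt_succ_of_le (hvD k (mem_range.mp hk)))

omit [DecidableEq X] in
/-- **Eq. (48) along a path of the overlap graph**: if `v_0, …, v_n` (`n ≥ 1`) are distinct indices in
`{0,…,D}` with consecutive overlaps `Σ_x min{φ_{v_k}, φ_{v_{k+1}}} ≥ δ`, then
`δ C(φ_{v_0}, φ_{v_n})(f) ≤ 2(2−δ) n Σ_{l ≤ D} V_l(f)`.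
[cite: MadrasRandall2002, §5 eq. (48) and the Remark after the proof] -/
theorem pairForm_le_of_path {φ : ℕ → X → ℝ} (hφ : ∀ j, ∀ x, 0 ≤ φ j x) (hφ1 : ∀ j, ∑ x, φ j x = 1)
    {δ : ℝ} (hδ : 0 < δ) (f : X → ℝ) {D n : ℕ} (hn : 1 ≤ n) {v : ℕ → ℕ} (hvD : ∀ k ≤ n, v k ≤ D)
    (hinj : ∀ k ≤ n, ∀ l ≤ n, v k = v l → k = l)
    (hov : ∀ k < n, δ ≤ ∑ x, min (φ (v k) x) (φ (v (k + 1)) x)) :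
    δ * pairForm (φ (v 0)) (φ (v n)) f
      ≤ 2 * (2 - δ) * n * ∑ l ∈ range (D + 1), lawVariance (φ l) f := by
  obtain ⟨n, rfl⟩ : ∃ n', n = n' + 1 := ⟨n - 1, by omega⟩
  set ψ : ℕ → X → ℝ := fun k => φ (v k) with hψ
  have hψ0 : ∀ j, ∀ x, 0 ≤ ψ j x := fun j => hφ (v j)
  have hψ1 : ∀ j, ∑ x, ψ j x = 1 := fun j => hφ1 (v j)
  have hV0 : ∀ l, 0 ≤ lawVariance (φ l) f := fun l => lawVariance_nonneg (hφ l) f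
  set S := ∑ l ∈ range (D + 1), lawVariance (φ l) f with hS
  -- (48), first line, along the path
  have hp := pairForm_le_path hψ0 hψ1 f 0 n
  simp only [hψ, Nat.zero_add] at hp
  -- (47) on each edge, summed
  have hedges : δ * ∑ k ∈ range (n + 1), pairForm (φ (v k)) (φ (v (k + 1))) f
      ≤ (2 - δ) * (2 * S) := by
    rw [mul_sum]
    calc ∑ k ∈ range (n + 1), δ * pairForm (φ (v k)) (φ (v (k + 1))) f
        ≤ ∑ k ∈ range (n + 1), (2 - δ) * (lawVariance (φ (v k)) f + lawVariance (φ (v (k + 1))) f) :=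
          sum_le_sum fun k hk => pairForm_le_of_overlap (hφ _) (hφ _) (hφ1 _) (hφ1 _) hδ
            (hov k (mem_range.mp hk)) f
      _ = (2 - δ) * (∑ k ∈ range (n + 1), lawVariance (φ (v k)) f
            + ∑ k ∈ range (n + 1), lawVariance (φ (v (k + 1))) f) := by
          rw [← mul_sum, sum_add_distrib]
      _ ≤ (2 - δ) * (2 * S) := by
          have hδ1 : δ ≤ 1 := by
            calc δ ≤ ∑ x, min (φ (v 0) x) (φ (v 1) x) := hov 0 (Nat.succ_pos n)
              _ ≤ ∑ x, φ (v 0) x := sum_le_sum fun x _ => min_le_left _ _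
              _ = 1 := hφ1 _
          refine mul_le_mul_of_nonneg_left ?_ (by linarith)
          have h1 : ∑ k ∈ range (n + 1), lawVariance (φ (v k)) f ≤ S :=
            sum_comp_le_sum_range (V := fun l => lawVariance (φ l) f) hV0
              (fun k hk => hvD k (le_of_lt hk))
              (fun k hk l hl h => hinj k (le_of_lt hk) l (le_of_lt hl) h)
          have h2 : ∑ k ∈ range (n + 1), lawVariance (φ (v (k + 1))) f ≤ S :=
            sum_comp_le_sum_range (V := fun l => lawVariance (φ l) f) hV0 (v := fun k => v (k + 1))
              (fun k hk => hvD (k + 1) hk)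
              (fun k hk l hl h => Nat.succ_injective (hinj (k + 1) hk (l + 1) hl h))
          linarith
  have hpn0 : 0 ≤ ∑ k ∈ range (n + 1), pairForm (φ (v k)) (φ (v (k + 1))) f :=
    sum_nonneg fun k _ => pairForm_nonneg (hφ _) (hφ _) f
  calc δ * pairForm (φ (v 0)) (φ (v (n + 1))) f
      ≤ δ * ((n + 1) * ∑ k ∈ range (n + 1), pairForm (φ (v k)) (φ (v (k + 1))) f) :=
        mul_le_mul_of_nonneg_left hp hδ.le
    _ = (n + 1) * (δ * ∑ k ∈ range (n + 1), pairForm (φ (v k)) (φ (v (k + 1))) f) := by ring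
    _ ≤ (n + 1) * ((2 - δ) * (2 * S)) := mul_le_mul_of_nonneg_left hedges (by positivity)
    _ = 2 * (2 - δ) * ((n + 1 : ℕ) : ℝ) * S := by push_cast; ring

omit [DecidableEq X] in
/-- **Eqs. (42)–(43) from a uniform bound**: if `δ C_{ij}(f) ≤ K` for all `i, j ≤ D` then
`δ · 2V_mix(f) ≤ K` (`a_j ≥ 0`, `Σ a_j = 1`). [cite: MadrasRandall2002, §5 eqs. (42)–(43)] -/
theorem two_mul_lawVariance_mixture_le_of_bound {a : ℕ → ℝ} {φ : ℕ → X → ℝ} {D : ℕ}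
    (ha : ∀ j ≤ D, 0 ≤ a j) (ha1 : ∑ j ∈ range (D + 1), a j = 1) (hφ1 : ∀ j, ∑ x, φ j x = 1)
    {δ K : ℝ} (f : X → ℝ) (hK : ∀ i ≤ D, ∀ j ≤ D, δ * pairForm (φ i) (φ j) f ≤ K) :
    δ * (2 * lawVariance (mixture a φ D) f) ≤ K := by
  rw [two_mul_lawVariance_mixture ha1 (fun j _ => hφ1 j), mul_sum]
  calc ∑ i ∈ range (D + 1), δ * ∑ j ∈ range (D + 1), a i * a j * pairForm (φ i) (φ j) f
      ≤ ∑ i ∈ range (D + 1), ∑ j ∈ range (D + 1), a i * a j * K := by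
        refine sum_le_sum fun i hi => ?_
        rw [mul_sum]
        refine sum_le_sum fun j hj => ?_
        have hi' := Nat.lt_succ_iff.mp (mem_range.mp hi)
        have hj' := Nat.lt_succ_iff.mp (mem_range.mp hj)
        calc δ * (a i * a j * pairForm (φ i) (φ j) f) = a i * a j * (δ * pairForm (φ i) (φ j) f) := by
              ring
          _ ≤ a i * a j * K :=
              mul_le_mul_of_nonneg_left (hK i hi' j hj') (mul_nonneg (ha i hi') (ha j hj'))
    _ = (∑ i ∈ range (D + 1), a i) * (∑ j ∈ range (D + 1), a j) * K := by
        rw [sum_mul, sum_mul]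
        refine sum_congr rfl fun i _ => ?_
        rw [mul_sum, sum_mul]
    _ = K := by rw [ha1]; ring

/-- **THEOREM 1.2 on an overlap graph (the Remark after the proof), Poincaré form.**  Suppose that any
two distinct indices `i, j ≤ D` are joined by a path `i = v_0, v_1, …, v_n = j` of at most `M` edges
with distinct vertices in `{0,…,D}` along which consecutive densities overlap,
`Σ_x min{φ_{v_k}(x), φ_{v_{k+1}}(x)} ≥ δ > 0` (for the paper's `M` = the diameter of the overlap graph
take shortest paths).  If `𝓔_j(f) ≥ λ_j V_j(f)` and `0 ≤ m ≤ a_j λ_j` for all `j ≤ D`, then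
**`𝓔_mix(f) ≥ (δ/(2M))·m·V_mix(f)`**. [cite: MadrasRandall2002, §5 Remark after the proof of
Theorem 1.2 ("`Gap_mix ≥ (δ/2M) min_j a_j Gap_j`")] -/
theorem MadrasRandall2002_thm_1_2_graph {a : ℕ → ℝ} {φ : ℕ → X → ℝ} {D : ℕ}
    (ha : ∀ j ≤ D, 0 ≤ a j) (ha1 : ∑ j ∈ range (D + 1), a j = 1) (hφ : ∀ j, ∀ x, 0 ≤ φ j x)
    (hφ1 : ∀ j, ∑ x, φ j x = 1) (hD : 1 ≤ D) {R : X → X → ℝ} (hR : ∀ x y, 0 ≤ R x y) {δ : ℝ}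
    (hδ : 0 < δ) {M : ℕ}
    (hpath : ∀ i ≤ D, ∀ j ≤ D, i ≠ j → ∃ n ≤ M, ∃ v : ℕ → ℕ, v 0 = i ∧ v n = j ∧
      (∀ k ≤ n, v k ≤ D) ∧ (∀ k ≤ n, ∀ l ≤ n, v k = v l → k = l) ∧
      ∀ k < n, δ ≤ ∑ x, min (φ (v k) x) (φ (v (k + 1)) x))
    {lam : ℕ → ℝ} {m : ℝ} (hm0 : 0 ≤ m) (hm : ∀ j ≤ D, m ≤ a j * lam j)
    (hgap : ∀ j ≤ D, ∀ f : X → ℝ, lam j * lawVariance (φ j) f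
      ≤ dirichletForm (φ j) (mhKernel R (φ j) : Matrix X X ℝ) f) (f : X → ℝ) :
    δ / (2 * M) * m * lawVariance (mixture a φ D) f
      ≤ dirichletForm (mixture a φ D) (mhKernel R (mixture a φ D) : Matrix X X ℝ) f := by
  have hV0 : ∀ l, 0 ≤ lawVariance (φ l) f := fun l => lawVariance_nonneg (hφ l) f
  set S := ∑ l ∈ range (D + 1), lawVariance (φ l) f with hS
  have hS0 : 0 ≤ S := sum_nonneg fun l _ => hV0 l
  -- the path from `0` to `1` gives `M ≥ 1` and `δ ≤ 1`
  obtain ⟨n₀, hn₀M, v₀, hv₀0, hv₀n, -, -, hov₀⟩ := hpath 0 (Nat.zero_le D) 1 hD Nat.zero_ne_one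
  have hn₀ : 1 ≤ n₀ := by
    rcases Nat.eq_zero_or_pos n₀ with h | h
    · subst h; rw [hv₀0] at hv₀n; exact absurd hv₀n Nat.zero_ne_one
    · exact h
  have hM : (1 : ℝ) ≤ M := by exact_mod_cast hn₀.trans hn₀M
  have hMpos : (0 : ℝ) < M := by linarith
  have hδ1 : δ ≤ 1 := by
    calc δ ≤ ∑ x, min (φ (v₀ 0) x) (φ (v₀ 1) x) := hov₀ 0 hn₀
      _ ≤ ∑ x, φ (v₀ 0) x := sum_le_sum fun x _ => min_le_left _ _
      _ = 1 := hφ1 _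
  -- uniform bound `δ C_{ij} ≤ 2(2−δ) M S`
  have hK : ∀ i ≤ D, ∀ j ≤ D, δ * pairForm (φ i) (φ j) f ≤ 2 * (2 - δ) * M * S := by
    intro i hi j hj
    by_cases hij : i = j
    · subst hij
      rw [pairForm_self (hφ1 i)]
      have hVi : lawVariance (φ i) f ≤ S :=
        single_le_sum (f := fun l => lawVariance (φ l) f) (fun l _ => hV0 l)
          (mem_range.mpr (Nat.lt_succ_of_le hi))
      have h1 : (1 : ℝ) ≤ (2 - δ) * M := by nlinarith
      have h2 : S ≤ (2 - δ) * M * S := le_mul_of_one_le_left hS0 h1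
      have h3 : δ * lawVariance (φ i) f ≤ lawVariance (φ i) f := mul_le_of_le_one_left (hV0 i) hδ1
      linarith
    · obtain ⟨n, hnM, v, hv0, hvn, hvD, hinj, hov⟩ := hpath i hi j hj hij
      have hn : 1 ≤ n := by
        rcases Nat.eq_zero_or_pos n with h | h
        · subst h; rw [hv0] at hvn; exact absurd hvn hij
        · exact h
      have h := pairForm_le_of_path hφ hφ1 hδ f hn hvD hinj hov
      rw [hv0, hvn] at h
      have hnM' : (n : ℝ) ≤ M := by exact_mod_cast hnM
      calc δ * pairForm (φ i) (φ j) f ≤ 2 * (2 - δ) * n * S := h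
        _ ≤ 2 * (2 - δ) * M * S := by
            have : 0 ≤ 2 * (2 - δ) * S := by nlinarith
            nlinarith
  -- (42) and (41)
  have h42 := two_mul_lawVariance_mixture_le_of_bound ha ha1 hφ1 f hK
  have h41 := dirichletForm_mixture_ge ha (fun j _ => hφ j) hR f (a := a) (φ := φ) (D := D)
  have hsum : m * S
      ≤ ∑ j ∈ range (D + 1), a j * dirichletForm (φ j) (mhKernel R (φ j) : Matrix X X ℝ) f := by
    rw [hS, mul_sum]
    refine sum_le_sum fun j hj => ?_
    have hj' := Nat.lt_succ_iff.mp (mem_range.mp hj)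
    calc m * lawVariance (φ j) f ≤ a j * lam j * lawVariance (φ j) f :=
          mul_le_mul_of_nonneg_right (hm j hj') (hV0 j)
      _ = a j * (lam j * lawVariance (φ j) f) := by ring
      _ ≤ a j * dirichletForm (φ j) (mhKernel R (φ j) : Matrix X X ℝ) f :=
          mul_le_mul_of_nonneg_left (hgap j hj' f) (ha j hj')
  have h42' : δ * lawVariance (mixture a φ D) f ≤ 2 * M * S := by
    have hprod : 0 ≤ δ * (M * S) := mul_nonneg hδ.le (mul_nonneg hMpos.le hS0)
    linarith
  calc δ / (2 * M) * m * lawVariance (mixture a φ D) f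
      = m * (δ * lawVariance (mixture a φ D) f) / (2 * M) := by ring
    _ ≤ m * (2 * M * S) / (2 * M) :=
        div_le_div_of_nonneg_right (mul_le_mul_of_nonneg_left h42' hm0) (by linarith)
    _ = m * S := by field_simp
    _ ≤ _ := hsum.trans h41

/-- A Poincaré inequality `c·Var_μ f ≤ 𝓔_μ(P; f)` for all `f` gives `c ≤ Gap_R(μ,P)` as soon as some
set has `μ`-mass in `(0, ½]` (so that an admissible test function exists, as in the tree's Theorem
13.10). [cite: MadrasRandall2002, §1 eq. (7) (the gap as the infimum of `𝓔/Var` over non-constant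
`f`)] -/
theorem le_spectralGapR_of_poincare {μ : X → ℝ} (hμ1 : ∑ x, μ x = 1) {P : Matrix X X ℝ} {c : ℝ}
    (hP : ∀ f : X → ℝ, c * lawVariance μ f ≤ dirichletForm μ P f)
    (hX : ∃ S : Finset X, 0 < ∑ x ∈ S, μ x ∧ ∑ x ∈ S, μ x ≤ 1 / 2) : c ≤ spectralGapR μ P := by
  obtain ⟨g, hg0, hg1⟩ := exists_mean_zero_piInner_one hμ1 hX
  refine le_csInf ⟨_, ⟨g, ⟨hg0, hg1⟩, rfl⟩⟩ ?_
  rintro _ ⟨f, ⟨hf0, hf1⟩, rfl⟩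
  have hvar : lawVariance μ f = 1 := by
    have hmean : lawMean μ f = 0 := hf0
    unfold lawVariance
    rw [hmean]
    unfold piInner at hf1
    rw [← hf1]
    exact sum_congr rfl fun x _ => by ring
  have h := hP f
  rw [hvar, mul_one] at h
  exact h

/-- If NO set has `μ`-mass in `(0, ½]` (probability vector `μ ≥ 0`), then `μ` is a point mass: it
vanishes off one point. [cite: MadrasRandall2002, §1 eq. (7) (degenerate case of the infimum)] -/
theorem exists_eq_zero_off_point {μ : X → ℝ} (hμ0 : ∀ x, 0 ≤ μ x) (hμ1 : ∑ x, μ x = 1)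
    (hX : ¬ ∃ S : Finset X, 0 < ∑ x ∈ S, μ x ∧ ∑ x ∈ S, μ x ≤ 1 / 2) :
    ∃ x₀, ∀ x, x ≠ x₀ → μ x = 0 := by
  push Not at hX
  -- every singleton has `μ`-mass `0` or `> 1/2`
  have hdich : ∀ x, μ x = 0 ∨ 1 / 2 < μ x := fun x => by
    rcases (hμ0 x).eq_or_lt with h | h
    · exact Or.inl h.symm
    · right
      have := hX {x} (by rw [sum_singleton]; exact h)
      rwa [sum_singleton] at this
  -- some `x₀` carries mass, hence `> 1/2`, and every other point carries none
  obtain ⟨x₀, hx₀⟩ : ∃ x₀, 1 / 2 < μ x₀ := by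
    by_contra hne
    push Not at hne
    have hz : ∀ x, μ x = 0 := fun x => (hdich x).resolve_right (not_lt.mpr (hne x))
    have : ∑ x, μ x = 0 := sum_eq_zero fun x _ => hz x
    linarith
  refine ⟨x₀, fun x hx => (hdich x).resolve_right fun hhalf => ?_⟩
  have hle : μ x + μ x₀ ≤ ∑ y, μ y := by
    rw [← sum_pair hx]
    exact sum_le_sum_of_subset_of_nonneg (subset_univ _) fun y _ _ => hμ0 y
  linarith

/-- A point mass has no admissible test function: `Gap_R(φ, P) = sInf ∅ = 0` when the probability
vector `φ` vanishes off one point. [cite: MadrasRandall2002, §1 eq. (7) (degenerate case)] -/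
theorem spectralGapR_eq_zero_of_eq_zero_off_point {φ : X → ℝ} (hφ1 : ∑ x, φ x = 1) {x₀ : X}
    (hz : ∀ x, x ≠ x₀ → φ x = 0) (P : Matrix X X ℝ) : spectralGapR φ P = 0 := by
  have hone : φ x₀ = 1 := by
    have h := hφ1
    rw [← sum_erase_add _ _ (mem_univ x₀)] at h
    have hz' : ∑ x ∈ univ.erase x₀, φ x = 0 := sum_eq_zero fun x hx => hz x (ne_of_mem_erase hx)
    linarith
  have hempty : ({f : X → ℝ | ∑ x, φ x * f x = 0 ∧ piInner φ f f = 1} : Set (X → ℝ)) = ∅ := by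
    rw [Set.eq_empty_iff_forall_notMem]
    rintro f ⟨hf0, hf1⟩
    have hf : f x₀ = 0 := by
      have h := hf0
      rw [← sum_erase_add _ _ (mem_univ x₀)] at h
      have hz' : ∑ x ∈ univ.erase x₀, φ x * f x = 0 :=
        sum_eq_zero fun x hx => by rw [hz x (ne_of_mem_erase hx), zero_mul]
      rw [hz', zero_add, hone, one_mul] at h
      exact h
    have hin : piInner φ f f = 0 := by
      unfold piInner
      rw [← sum_erase_add _ _ (mem_univ x₀)]
      have hz' : ∑ x ∈ univ.erase x₀, φ x * (f x * f x) = 0 :=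
        sum_eq_zero fun x hx => by rw [hz x (ne_of_mem_erase hx), zero_mul]
      rw [hz', zero_add, hf, mul_zero, mul_zero]
    rw [hin] at hf1
    exact absurd hf1 (by norm_num)
  unfold spectralGapR
  rw [hempty, Set.image_empty, Real.sInf_empty]

omit [DecidableEq X] in
/-- `min_j a_j Gap_j ≥ 0`. [cite: MadrasRandall2002, §1 Theorem 1.2] -/
theorem inf'_weightedGap_nonneg {a : ℕ → ℝ} {φ : ℕ → X → ℝ} {D : ℕ} (ha : ∀ j ≤ D, 0 ≤ a j)
    (hφ : ∀ j, ∀ x, 0 ≤ φ j x) {P : ℕ → Matrix X X ℝ} (hP : ∀ j, ∀ x y, 0 ≤ P j x y) :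
    0 ≤ (range (D + 1)).inf' (nonempty_range_iff.mpr (Nat.succ_ne_zero D))
      (fun j => a j * spectralGapR (φ j) (P j)) :=
  (le_inf'_iff _ _).mpr fun j hj => mul_nonneg (ha j (Nat.lt_succ_iff.mp (mem_range.mp hj)))
    (spectralGapR_nonneg (hφ j) (hP j))

/-- From a Poincaré inequality for `R[φ_mix]` with constant `c · min_j a_j Gap_j` to the gap
bound `Gap_mix ≥ c · min_j a_j Gap_j` — including the degenerate case of a point mass `φ_mix` (no
admissible test function; then `φ_j` is the same point mass for every `a_j > 0`, so both sides are the
empty infimum `0`). [cite: MadrasRandall2002, §1 eq. (7) and Theorem 1.2 (the gap as an infimum over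
non-constant `f`)] -/
theorem le_spectralGapR_mixture {a : ℕ → ℝ} {φ : ℕ → X → ℝ} {D : ℕ} (ha : ∀ j ≤ D, 0 ≤ a j)
    (ha1 : ∑ j ∈ range (D + 1), a j = 1) (hφ : ∀ j, ∀ x, 0 ≤ φ j x) (hφ1 : ∀ j, ∑ x, φ j x = 1)
    {R : X → X → ℝ} (hR : ∀ x y, 0 ≤ R x y) (hRrow : ∀ x, ∑ y, R x y ≤ 1) {c : ℝ}
    (hP : ∀ f : X → ℝ, c * (range (D + 1)).inf' (nonempty_range_iff.mpr (Nat.succ_ne_zero D))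
        (fun j => a j * spectralGapR (φ j) (mhKernel R (φ j) : Matrix X X ℝ))
        * lawVariance (mixture a φ D) f
      ≤ dirichletForm (mixture a φ D) (mhKernel R (mixture a φ D) : Matrix X X ℝ) f) :
    c * (range (D + 1)).inf' (nonempty_range_iff.mpr (Nat.succ_ne_zero D))
        (fun j => a j * spectralGapR (φ j) (mhKernel R (φ j) : Matrix X X ℝ))
      ≤ spectralGapR (mixture a φ D) (mhKernel R (mixture a φ D) : Matrix X X ℝ) := by
  set m := (range (D + 1)).inf' (nonempty_range_iff.mpr (Nat.succ_ne_zero D))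
    (fun j => a j * spectralGapR (φ j) (mhKernel R (φ j) : Matrix X X ℝ)) with hm
  set μ := mixture a φ D with hμ
  have hμ0 : ∀ x, 0 ≤ μ x := mixture_nonneg ha fun j _ => hφ j
  have hμ1 : ∑ x, μ x = 1 := sum_mixture ha1 fun j _ => hφ1 j
  have hMH0 : ∀ j, ∀ x y, 0 ≤ (mhKernel R (φ j) : Matrix X X ℝ) x y := fun j x y =>
    mhKernel_nonneg_of_nonneg (hφ j) hR hRrow x y
  have hMHμ0 : ∀ x y, 0 ≤ (mhKernel R μ : Matrix X X ℝ) x y := fun x y =>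
    mhKernel_nonneg_of_nonneg hμ0 hR hRrow x y
  have hm0 : 0 ≤ m := inf'_weightedGap_nonneg ha hφ hMH0
  by_cases hX : ∃ S : Finset X, 0 < ∑ x ∈ S, μ x ∧ ∑ x ∈ S, μ x ≤ 1 / 2
  · exact le_spectralGapR_of_poincare hμ1 hP hX
  · -- degenerate case: `μ` is a point mass at some `x₀`; show `m ≤ 0 ≤ Gap_mix`
    have hgap0 : 0 ≤ spectralGapR μ (mhKernel R μ : Matrix X X ℝ) := spectralGapR_nonneg hμ0 hMHμ0
    suffices hmle : m ≤ 0 by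
      have : m = 0 := le_antisymm hmle hm0
      rw [this, mul_zero]
      exact hgap0
    obtain ⟨x₀, hzero⟩ := exists_eq_zero_off_point hμ0 hμ1 hX
    have h0 : (0 : ℕ) ∈ range (D + 1) := mem_range.mpr (Nat.succ_pos D)
    rcases (ha 0 (Nat.zero_le D)).eq_or_lt with ha0 | ha0
    · calc m ≤ a 0 * spectralGapR (φ 0) (mhKernel R (φ 0) : Matrix X X ℝ) := inf'_le _ h0
        _ = 0 := by rw [← ha0, zero_mul]
    · -- `a_0 > 0`: `φ_0 ≤ μ/a_0` is the same point mass, so `Gap_0 = sInf ∅ = 0`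
      have hφz : ∀ x, x ≠ x₀ → φ 0 x = 0 := fun x hx => by
        have hle : a 0 * φ 0 x ≤ μ x := by
          show a 0 * φ 0 x ≤ ∑ j ∈ range (D + 1), a j * φ j x
          exact single_le_sum (f := fun j => a j * φ j x)
            (fun j hj => mul_nonneg (ha j (Nat.lt_succ_iff.mp (mem_range.mp hj))) (hφ j x)) h0
        rw [hzero x hx] at hle
        have : φ 0 x ≤ 0 := by
          by_contra hpos
          push Not at hpos
          linarith [mul_pos ha0 hpos]
        exact le_antisymm this (hφ 0 x)
      calc m ≤ a 0 * spectralGapR (φ 0) (mhKernel R (φ 0) : Matrix X X ℝ) := inf'_le _ h0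
        _ = 0 := by rw [spectralGapR_eq_zero_of_eq_zero_off_point (hφ1 0) hφz, mul_zero]

/-- **THEOREM 1.2 (Density Decomposition Theorem) exactly as printed** — no non-degeneracy
hypothesis: **`Gap_mix ≥ (δ/(2D)) min_{j=0,…,D} a_j Gap_j`** for any proposal matrix `R ≥ 0` with row
sums `≤ 1`, weights `a_j ≥ 0` adding up to `1`, probability vectors `φ_0, …, φ_D` (`D ≥ 1`) with
neighbour overlaps `≥ δ > 0` (for a point mass `φ_mix` both sides are `0`).
[cite: MadrasRandall2002, §1 Theorem 1.2, eq. (12)] -/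
theorem MadrasRandall2002_thm_1_2_spectralGapR' {a : ℕ → ℝ} {φ : ℕ → X → ℝ} {D : ℕ}
    (ha : ∀ j ≤ D, 0 ≤ a j) (ha1 : ∑ j ∈ range (D + 1), a j = 1) (hφ : ∀ j, ∀ x, 0 ≤ φ j x)
    (hφ1 : ∀ j, ∑ x, φ j x = 1) (hD : 1 ≤ D) {R : X → X → ℝ} (hR : ∀ x y, 0 ≤ R x y)
    (hRrow : ∀ x, ∑ y, R x y ≤ 1) {δ : ℝ} (hδ : 0 < δ)
    (hover : ∀ j < D, δ ≤ ∑ x, min (φ j x) (φ (j + 1) x)) :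
    δ / (2 * D) * (range (D + 1)).inf' (nonempty_range_iff.mpr (Nat.succ_ne_zero D))
        (fun j => a j * spectralGapR (φ j) (mhKernel R (φ j) : Matrix X X ℝ))
      ≤ spectralGapR (mixture a φ D) (mhKernel R (mixture a φ D) : Matrix X X ℝ) := by
  have hMH0 : ∀ j, ∀ x y, 0 ≤ (mhKernel R (φ j) : Matrix X X ℝ) x y := fun j x y =>
    mhKernel_nonneg_of_nonneg (hφ j) hR hRrow x y
  refine le_spectralGapR_mixture ha ha1 hφ hφ1 hR hRrow fun f => ?_
  exact MadrasRandall2002_thm_1_2 ha ha1 hφ hφ1 hD hR hδ hover (inf'_weightedGap_nonneg ha hφ hMH0)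
    (fun j hj => inf'_le _ (mem_range.mpr (Nat.lt_succ_of_le hj)))
    (fun j _ g => by
      rcases (lawVariance_nonneg (hφ j) g).eq_or_lt with hV | hV
      · rw [← hV, mul_zero]
        exact dirichletForm_nonneg (hφ j) (hMH0 j) g
      · exact (le_div_iff₀ hV).mp
          (spectralGapR_le_dirichletForm_div_lawVariance (hφ j) (hφ1 j) (hMH0 j) hV)) f

/-- **THEOREM 1.2 on an overlap graph (the Remark after the proof), as printed**:
**`Gap_mix ≥ (δ/(2M)) min_{j=0,…,D} a_j Gap_j`** when any two distinct indices are joined by a path of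
at most `M` edges with distinct vertices along which consecutive densities overlap by `≥ δ` (`M` = the
diameter of the overlap graph, via shortest paths). [cite: MadrasRandall2002, §5 Remark after the
proof of Theorem 1.2] -/
theorem MadrasRandall2002_thm_1_2_graph_spectralGapR {a : ℕ → ℝ} {φ : ℕ → X → ℝ} {D : ℕ}
    (ha : ∀ j ≤ D, 0 ≤ a j) (ha1 : ∑ j ∈ range (D + 1), a j = 1) (hφ : ∀ j, ∀ x, 0 ≤ φ j x)
    (hφ1 : ∀ j, ∑ x, φ j x = 1) (hD : 1 ≤ D) {R : X → X → ℝ} (hR : ∀ x y, 0 ≤ R x y)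
    (hRrow : ∀ x, ∑ y, R x y ≤ 1) {δ : ℝ} (hδ : 0 < δ) {M : ℕ}
    (hpath : ∀ i ≤ D, ∀ j ≤ D, i ≠ j → ∃ n ≤ M, ∃ v : ℕ → ℕ, v 0 = i ∧ v n = j ∧
      (∀ k ≤ n, v k ≤ D) ∧ (∀ k ≤ n, ∀ l ≤ n, v k = v l → k = l) ∧
      ∀ k < n, δ ≤ ∑ x, min (φ (v k) x) (φ (v (k + 1)) x)) :
    δ / (2 * M) * (range (D + 1)).inf' (nonempty_range_iff.mpr (Nat.succ_ne_zero D))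
        (fun j => a j * spectralGapR (φ j) (mhKernel R (φ j) : Matrix X X ℝ))
      ≤ spectralGapR (mixture a φ D) (mhKernel R (mixture a φ D) : Matrix X X ℝ) := by
  have hMH0 : ∀ j, ∀ x y, 0 ≤ (mhKernel R (φ j) : Matrix X X ℝ) x y := fun j x y =>
    mhKernel_nonneg_of_nonneg (hφ j) hR hRrow x y
  refine le_spectralGapR_mixture ha ha1 hφ hφ1 hR hRrow fun f => ?_
  exact MadrasRandall2002_thm_1_2_graph ha ha1 hφ hφ1 hD hR hδ hpath
    (inf'_weightedGap_nonneg ha hφ hMH0) (fun j hj => inf'_le _ (mem_range.mpr (Nat.lt_succ_of_le hj)))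
    (fun j _ g => by
      rcases (lawVariance_nonneg (hφ j) g).eq_or_lt with hV | hV
      · rw [← hV, mul_zero]
        exact dirichletForm_nonneg (hφ j) (hMH0 j) g
      · exact (le_div_iff₀ hV).mp
          (spectralGapR_le_dirichletForm_div_lawVariance (hφ j) (hφ1 j) (hMH0 j) hV)) f

/-! ## Lemma 3.1 (Madras–Piccioni): comparable densities give comparable Metropolis–Hastings gaps -/

/-- **LEMMA 3.1, one-sided core**: if `a·r₂ ≤ r₁ ≤ b·r₂` pointwise (`a, b > 0`; probability vectors
`r₁, r₂ ≥ 0`; proposal `R ≥ 0` with row sums `≤ 1`), then **`(a/b)·Gap(R[r₂]) ≤ Gap(R[r₁])`**.  Proof as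
indicated in the paper ("a consequence of the definition of the spectral gap (7)"): the edge weights
satisfy `min{r₁(x)R(x,y), r₁(y)R(y,x)} ≥ a·min{r₂(x)R(x,y), r₂(y)R(y,x)}`, so `𝓔₁ ≥ a𝓔₂`, while
`Var_{r₁} f ≤ E_{r₁}(f − E_{r₂}f)² ≤ b·Var_{r₂} f`. [cite: MadrasRandall2002, §3 Lemma 3.1,
eqs. (22)–(23)] -/
theorem MadrasRandall2002_lemma_3_1_core {r₁ r₂ : X → ℝ} (h10 : ∀ x, 0 ≤ r₁ x) (h20 : ∀ x, 0 ≤ r₂ x)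
    (h11 : ∑ x, r₁ x = 1) (h21 : ∑ x, r₂ x = 1) {R : X → X → ℝ} (hR : ∀ x y, 0 ≤ R x y)
    (hRrow : ∀ x, ∑ y, R x y ≤ 1) {a b : ℝ} (ha : 0 < a) (hb : 0 < b)
    (hlo : ∀ x, a * r₂ x ≤ r₁ x) (hhi : ∀ x, r₁ x ≤ b * r₂ x) :
    a / b * spectralGapR r₂ (mhKernel R r₂ : Matrix X X ℝ)
      ≤ spectralGapR r₁ (mhKernel R r₁ : Matrix X X ℝ) := by
  have hMH1 : ∀ x y, 0 ≤ (mhKernel R r₁ : Matrix X X ℝ) x y := fun x y =>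
    mhKernel_nonneg_of_nonneg h10 hR hRrow x y
  have hMH2 : ∀ x y, 0 ≤ (mhKernel R r₂ : Matrix X X ℝ) x y := fun x y =>
    mhKernel_nonneg_of_nonneg h20 hR hRrow x y
  have hG2 : 0 ≤ spectralGapR r₂ (mhKernel R r₂ : Matrix X X ℝ) := spectralGapR_nonneg h20 hMH2
  -- Dirichlet forms: `a 𝓔₂(f) ≤ 𝓔₁(f)`
  have hE : ∀ f : X → ℝ, a * dirichletForm r₂ (mhKernel R r₂ : Matrix X X ℝ) f
      ≤ dirichletForm r₁ (mhKernel R r₁ : Matrix X X ℝ) f := by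
    intro f
    rw [dirichletForm_mhKernel h20 hR, dirichletForm_mhKernel h10 hR, mul_left_comm, mul_sum]
    refine mul_le_mul_of_nonneg_left (sum_le_sum fun x _ => ?_) (by norm_num)
    rw [mul_sum]
    refine sum_le_sum fun y _ => ?_
    rw [← mul_assoc]
    refine mul_le_mul_of_nonneg_right ?_ (sq_nonneg _)
    unfold mhFlux
    rw [mul_min_of_nonneg _ _ ha.le]
    exact min_le_min (by nlinarith [hlo x, hR x y]) (by nlinarith [hlo y, hR y x])
  -- variances: `Var₁ f ≤ b Var₂ f` (the tree's eq. (13.12) argument)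
  have hV : ∀ f : X → ℝ, lawVariance r₁ f ≤ b * lawVariance r₂ f := by
    intro f
    set mt := lawMean r₂ f with hmt
    have h1 : lawVariance r₁ f ≤ piInner r₁ (fun x => f x - mt) (fun x => f x - mt) := by
      rw [piInner_sub_const_eq h11 f mt]
      nlinarith [sq_nonneg (lawMean r₁ f - mt)]
    have h2 : piInner r₁ (fun x => f x - mt) (fun x => f x - mt) ≤ b * lawVariance r₂ f := by
      unfold piInner lawVariance
      rw [mul_sum]
      refine sum_le_sum fun x _ => ?_
      rw [← hmt, ← sq, ← mul_assoc]
      exact mul_le_mul_of_nonneg_right (hhi x) (sq_nonneg _)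
    exact h1.trans h2
  -- Poincaré inequality for `R[r₁]` with constant `(a/b) Gap₂`
  have hP : ∀ f : X → ℝ, a / b * spectralGapR r₂ (mhKernel R r₂ : Matrix X X ℝ) * lawVariance r₁ f
      ≤ dirichletForm r₁ (mhKernel R r₁ : Matrix X X ℝ) f := by
    intro f
    have hgap : spectralGapR r₂ (mhKernel R r₂ : Matrix X X ℝ) * lawVariance r₂ f
        ≤ dirichletForm r₂ (mhKernel R r₂ : Matrix X X ℝ) f := by
      rcases (lawVariance_nonneg h20 f).eq_or_lt with hv | hv
      · rw [← hv, mul_zero]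
        exact dirichletForm_nonneg h20 hMH2 f
      · exact (le_div_iff₀ hv).mp (spectralGapR_le_dirichletForm_div_lawVariance h20 h21 hMH2 hv)
    calc a / b * spectralGapR r₂ (mhKernel R r₂ : Matrix X X ℝ) * lawVariance r₁ f
        ≤ a / b * spectralGapR r₂ (mhKernel R r₂ : Matrix X X ℝ) * (b * lawVariance r₂ f) :=
          mul_le_mul_of_nonneg_left (hV f) (mul_nonneg (div_nonneg ha.le hb.le) hG2)
      _ = a * (spectralGapR r₂ (mhKernel R r₂ : Matrix X X ℝ) * lawVariance r₂ f) := by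
          field_simp
      _ ≤ a * dirichletForm r₂ (mhKernel R r₂ : Matrix X X ℝ) f :=
          mul_le_mul_of_nonneg_left hgap ha.le
      _ ≤ _ := hE f
  by_cases hX : ∃ S : Finset X, 0 < ∑ x ∈ S, r₁ x ∧ ∑ x ∈ S, r₁ x ≤ 1 / 2
  · exact le_spectralGapR_of_poincare h11 hP hX
  · -- `r₁` is a point mass, hence so is `r₂ ≤ r₁/a`: both gaps are `sInf ∅ = 0`
    obtain ⟨x₀, hz⟩ := exists_eq_zero_off_point h10 h11 hX
    have hz2 : ∀ x, x ≠ x₀ → r₂ x = 0 := fun x hx => by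
      have h := hlo x
      rw [hz x hx] at h
      have : r₂ x ≤ 0 := by
        by_contra hpos
        push Not at hpos
        linarith [mul_pos ha hpos]
      exact le_antisymm this (h20 x)
    rw [spectralGapR_eq_zero_of_eq_zero_off_point h21 hz2, mul_zero]
    exact spectralGapR_nonneg h10 hMH1

/-- **LEMMA 3.1 (Madras–Piccioni)**: if `a ≤ r₁(x)/r₂(x) ≤ b` wherever `r₁, r₂` do not both vanish —
here `a·r₂ ≤ r₁ ≤ b·r₂` pointwise, `a, b > 0` — then the Metropolis–Hastings chains for a common
proposal `R` satisfy **`(a/b)·Gap(R[r₂]) ≤ Gap(R[r₁]) ≤ (b/a)·Gap(R[r₂])`**.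
[cite: MadrasRandall2002, §3 Lemma 3.1, eq. (23)] -/
theorem MadrasRandall2002_lemma_3_1 {r₁ r₂ : X → ℝ} (h10 : ∀ x, 0 ≤ r₁ x) (h20 : ∀ x, 0 ≤ r₂ x)
    (h11 : ∑ x, r₁ x = 1) (h21 : ∑ x, r₂ x = 1) {R : X → X → ℝ} (hR : ∀ x y, 0 ≤ R x y)
    (hRrow : ∀ x, ∑ y, R x y ≤ 1) {a b : ℝ} (ha : 0 < a) (hb : 0 < b)
    (hab : ∀ x, a * r₂ x ≤ r₁ x ∧ r₁ x ≤ b * r₂ x) :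
    a / b * spectralGapR r₂ (mhKernel R r₂ : Matrix X X ℝ)
        ≤ spectralGapR r₁ (mhKernel R r₁ : Matrix X X ℝ) ∧
      spectralGapR r₁ (mhKernel R r₁ : Matrix X X ℝ)
        ≤ b / a * spectralGapR r₂ (mhKernel R r₂ : Matrix X X ℝ) := by
  refine ⟨MadrasRandall2002_lemma_3_1_core h10 h20 h11 h21 hR hRrow ha hb (fun x => (hab x).1)
    fun x => (hab x).2, ?_⟩
  -- the roles reversed: `(1/b)·r₁ ≤ r₂ ≤ (1/a)·r₁`
  have h := MadrasRandall2002_lemma_3_1_core h20 h10 h21 h11 hR hRrow (one_div_pos.mpr hb)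
    (one_div_pos.mpr ha)
    (fun x => by rw [one_div, inv_mul_le_iff₀ hb]; exact (hab x).2)
    (fun x => by rw [one_div, le_inv_mul_iff₀ ha]; exact (hab x).1)
  have e : 1 / b / (1 / a) = a / b := by
    field_simp
  rw [e] at h
  -- `h : (a/b)·Gap₁ ≤ Gap₂`
  have hba : 0 < b / a := div_pos hb ha
  calc spectralGapR r₁ (mhKernel R r₁ : Matrix X X ℝ)
      = b / a * (a / b * spectralGapR r₁ (mhKernel R r₁ : Matrix X X ℝ)) := by
        field_simp
    _ ≤ b / a * spectralGapR r₂ (mhKernel R r₂ : Matrix X X ℝ) := mul_le_mul_of_nonneg_left h hba.le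

end Literature.Probability.MarkovChains.DensityDecomposition

/-! # Third block: Proposition 3.2 (Madras–Piccioni) — umbrella sampling is at least as good as
# simulated tempering

[cite: MadrasRandall2002, §2 eqs. (13)–(17) (the simulated tempering chain `QPQ` on the augmented space
`S = Ω × {labels}`), §3 eq. (24) and PROPOSITION 3.2 ("`Gap(QPQ) ≤ Gap(R[κ])`"), Appendix B (its
proof: restrict the infimum (71) to functions `f(x,i) = g(x)`)].  Finite setting as above: labels
`Fin (D+1)`, weights `c_j ≥ 0` adding up to `1`, probability vectors `φ_j`, the umbrella (mixture)
density `κ = Σ_j c_j φ_j = mixture c φ D`, `T_j = R[φ_j]` the Metropolis–Hastings chains for a common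
proposal `R ≥ 0` (row sums `≤ 1`), `ψ(x,i) = c_i φ_i(x)` on `X × Fin (D+1)` (eq. (17)),
`P((x,i),(y,j)) = δ_{ij} T_i(x,y)` (eq. (15)), `Q((x,i),(y,j)) = δ_{xy} c_j φ_j(x)/κ(x)` (eq. (16); rows
with `κ(x) = 0`, a `ψ`-null set, are `0` by the `x/0 = 0` convention).  PROVED:
`MadrasRandall2002_prop_3_2 : Gap_R(ψ, QPQ) ≤ Gap_R(κ, R[κ])` whenever `κ` is not a point mass (for a
point mass the right side is the empty infimum `0` while the label walk still mixes, so the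
hypothesis is needed with this convention). -/

namespace Literature.Probability.MarkovChains.DensityDecomposition

open Finset Matrix

variable {X : Type*} [Fintype X] [DecidableEq X]

/-- The simulated-tempering measure `ψ(x,i) = c_i φ_i(x)` on the augmented space.
[cite: MadrasRandall2002, §2 eq. (17)] -/
def temperingLaw (c : ℕ → ℝ) (φ : ℕ → X → ℝ) (D : ℕ) (p : X × Fin (D + 1)) : ℝ :=
  c p.2 * φ p.2 p.1

/-- The within-label kernel `P((x,i),(y,j)) = δ_{ij} T_i(x,y)`, `T_i = R[φ_i]`.
[cite: MadrasRandall2002, §2 eq. (15)] -/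
noncomputable def temperingMove (R : X → X → ℝ) (φ : ℕ → X → ℝ) (D : ℕ) :
    Matrix (X × Fin (D + 1)) (X × Fin (D + 1)) ℝ :=
  of fun p q => if q.2 = p.2 then mhKernel R (φ p.2) p.1 q.1 else 0

/-- The label-resampling kernel `Q((x,i),(y,j)) = δ_{xy} c_j φ_j(x)/κ(x)`, `κ = Σ_l c_l φ_l`.
[cite: MadrasRandall2002, §2 eq. (16)] -/
noncomputable def temperingLabel (c : ℕ → ℝ) (φ : ℕ → X → ℝ) (D : ℕ) :
    Matrix (X × Fin (D + 1)) (X × Fin (D + 1)) ℝ :=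
  of fun p q => if q.1 = p.1 then c q.2 * φ q.2 p.1 / mixture c φ D p.1 else 0

/-- The simulated tempering chain `QPQ`. [cite: MadrasRandall2002, §2 ("We shall use the version
`QPQ`, since it is reversible with respect to `ψ`")] -/
noncomputable def temperingChain (R : X → X → ℝ) (c : ℕ → ℝ) (φ : ℕ → X → ℝ) (D : ℕ) :
    Matrix (X × Fin (D + 1)) (X × Fin (D + 1)) ℝ :=
  temperingLabel c φ D * temperingMove R φ D * temperingLabel c φ D

omit [Fintype X] [DecidableEq X] in
/-- `Σ_{i : Fin (D+1)} c_i φ_i(x) = κ(x)`. [cite: MadrasRandall2002, §2 eq. (18)] -/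
theorem sum_fin_weight_eq_mixture (c : ℕ → ℝ) (φ : ℕ → X → ℝ) (D : ℕ) (x : X) :
    ∑ i : Fin (D + 1), c i * φ i x = mixture c φ D x := by
  unfold mixture
  exact Fin.sum_univ_eq_sum_range (fun j => c j * φ j x) (D + 1)

/-- The entries of `QPQ`: `(QPQ)((x,i),(y,j)) = Σ_k (c_kφ_k(x)/κ(x)) T_k(x,y) (c_jφ_j(y)/κ(y))`.
[cite: MadrasRandall2002, Appendix B (the display after eq. (71))] -/
theorem temperingChain_apply (R : X → X → ℝ) (c : ℕ → ℝ) (φ : ℕ → X → ℝ) (D : ℕ)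
    (p q : X × Fin (D + 1)) :
    temperingChain R c φ D p q
      = ∑ k : Fin (D + 1), c k * φ k p.1 / mixture c φ D p.1 * mhKernel R (φ k) p.1 q.1
          * (c q.2 * φ q.2 q.1 / mixture c φ D q.1) := by
  unfold temperingChain
  rw [mul_apply]
  -- `(QP)(p, r) Q(r, q)` vanishes unless `r.1 = q.1`
  have hQP : ∀ r : X × Fin (D + 1), (temperingLabel c φ D * temperingMove R φ D) p r
      = c r.2 * φ r.2 p.1 / mixture c φ D p.1 * mhKernel R (φ r.2) p.1 r.1 := by
    intro r
    rw [mul_apply, Fintype.sum_prod_type]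
    simp only [temperingLabel, temperingMove, of_apply]
    rw [sum_eq_single p.1]
    · rw [Fintype.sum_eq_single r.2]
      · simp
      · intro k hk
        simp [Ne.symm hk]
    · intro x _ hx
      simp [hx]
    · intro h; exact absurd (mem_univ _) h
  simp_rw [hQP]
  rw [Fintype.sum_prod_type]
  simp only [temperingLabel, of_apply]
  rw [sum_eq_single q.1]
  · simp
  · intro y _ hy
    simp [Ne.symm hy]
  · intro h; exact absurd (mem_univ _) h

omit [DecidableEq X] in
/-- The `ψ`-mean of a label-free function `f(x,i) = g(x)` is the `κ`-mean of `g`.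
[cite: MadrasRandall2002, §2 eq. (18) (the marginal of the configuration is `φ̄ = κ`)] -/
theorem sum_temperingLaw_mul_comp_fst (c : ℕ → ℝ) (φ : ℕ → X → ℝ) (D : ℕ) (g : X → ℝ) :
    ∑ p : X × Fin (D + 1), temperingLaw c φ D p * g p.1 = ∑ x, mixture c φ D x * g x := by
  rw [Fintype.sum_prod_type]
  refine sum_congr rfl fun x _ => ?_
  simp only [temperingLaw]
  rw [← sum_fin_weight_eq_mixture, sum_mul]

omit [DecidableEq X] in
/-- `⟨f,f⟩_ψ = ⟨g,g⟩_κ` for `f(x,i) = g(x)`. [cite: MadrasRandall2002, Appendix B ("the denominator of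
(71) equals `∫∫|g(x) − g(y)|² κ(x)λ(dx)κ(y)λ(dy)`")] -/
theorem piInner_temperingLaw_comp_fst (c : ℕ → ℝ) (φ : ℕ → X → ℝ) (D : ℕ) (g : X → ℝ) :
    piInner (temperingLaw c φ D) (fun p => g p.1) (fun p => g p.1) = piInner (mixture c φ D) g g := by
  unfold piInner
  exact sum_temperingLaw_mul_comp_fst c φ D (fun x => g x * g x)

omit [DecidableEq X] in
/-- `ψ` is a probability vector when the weights add up to `1` and the `φ_j` are probability vectors
("the marginal probability of the label `i` is `c_i`"). [cite: MadrasRandall2002, §2 eq. (17)] -/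
theorem sum_temperingLaw {c : ℕ → ℝ} {φ : ℕ → X → ℝ} {D : ℕ} (hc1 : ∑ j ∈ range (D + 1), c j = 1)
    (hφ1 : ∀ j ≤ D, ∑ x, φ j x = 1) : ∑ p : X × Fin (D + 1), temperingLaw c φ D p = 1 := by
  have h := sum_temperingLaw_mul_comp_fst c φ D fun _ => 1
  simp only [mul_one] at h
  rw [h, sum_mixture hc1 hφ1]

/-- `QPQ ≥ 0` entrywise (`c_j ≥ 0`, `φ_j ≥ 0`, `R ≥ 0` with row sums `≤ 1`).
[cite: MadrasRandall2002, §2 eqs. (15)–(16)] -/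
theorem temperingChain_nonneg {c : ℕ → ℝ} {φ : ℕ → X → ℝ} {D : ℕ} (hc : ∀ j ≤ D, 0 ≤ c j)
    (hφ : ∀ j, ∀ x, 0 ≤ φ j x) {R : X → X → ℝ} (hR : ∀ x y, 0 ≤ R x y)
    (hRrow : ∀ x, ∑ y, R x y ≤ 1) (p q : X × Fin (D + 1)) : 0 ≤ temperingChain R c φ D p q := by
  rw [temperingChain_apply]
  have hκ0 : ∀ x, 0 ≤ mixture c φ D x := mixture_nonneg hc fun j _ => hφ j
  have hk0 : ∀ k : Fin (D + 1), ∀ x, 0 ≤ c k * φ k x := fun k x =>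
    mul_nonneg (hc k (Nat.lt_succ_iff.mp k.isLt)) (hφ k x)
  exact sum_nonneg fun k _ => mul_nonneg (mul_nonneg (div_nonneg (hk0 k p.1) (hκ0 p.1))
    (mhKernel_nonneg_of_nonneg (hφ k) hR hRrow p.1 q.1)) (div_nonneg (hk0 q.2 q.1) (hκ0 q.1))

/-- **The key estimate of Appendix B**: for a label-free test function `f(x,i) = g(x)`,
`𝓔_ψ(QPQ; f) ≤ Σ_k c_k 𝓔_{φ_k}(T_k; g) ≤ 𝓔_κ(R[κ]; g)` — "the numerator of (71) equals
`∫∫|g(x)−g(y)|² Σ_i c_iφ_i(x) Σ_k (c_kφ_k(x)/κ(x)) R(x,dy) min{1, φ_k(y)ρ(x)/(φ_k(x)ρ(y))} ≤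
∫∫|g(x)−g(y)|² R(x,dy) min{Σ_k c_kφ_k(x), Σ_k c_kφ_k(y)ρ(x)/ρ(y)}`".
[cite: MadrasRandall2002, Appendix B (proof of Proposition 3.2)] -/
theorem dirichletForm_temperingChain_comp_fst_le {c : ℕ → ℝ} {φ : ℕ → X → ℝ} {D : ℕ}
    (hc : ∀ j ≤ D, 0 ≤ c j) (hφ : ∀ j, ∀ x, 0 ≤ φ j x) {R : X → X → ℝ} (hR : ∀ x y, 0 ≤ R x y)
    (hRrow : ∀ x, ∑ y, R x y ≤ 1) (g : X → ℝ) :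
    dirichletForm (temperingLaw c φ D) (temperingChain R c φ D) (fun p => g p.1)
      ≤ dirichletForm (mixture c φ D) (mhKernel R (mixture c φ D) : Matrix X X ℝ) g := by
  set κ := mixture c φ D with hκ
  have hκ0 : ∀ x, 0 ≤ κ x := mixture_nonneg hc fun j _ => hφ j
  have hk0 : ∀ k : Fin (D + 1), ∀ x, 0 ≤ c k * φ k x := fun k x =>
    mul_nonneg (hc k (Nat.lt_succ_iff.mp k.isLt)) (hφ k x)
  have hT0 : ∀ k : Fin (D + 1), ∀ x y, 0 ≤ mhKernel R (φ k) x y := fun k x y =>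
    mhKernel_nonneg_of_nonneg (hφ k) hR hRrow x y
  -- `κ(x) · (c_kφ_k(x)/κ(x)) = c_kφ_k(x)` (also when `κ(x) = 0`, for then `φ_k(x) = 0` or `c_k = 0`)
  have hcancel : ∀ k : Fin (D + 1), ∀ x, κ x * (c k * φ k x / κ x) = c k * φ k x := by
    intro k x
    by_cases hz : κ x = 0
    · have hle : c k * φ k x ≤ κ x := by
        rw [hκ, ← sum_fin_weight_eq_mixture]
        exact single_le_sum (f := fun i : Fin (D + 1) => c i * φ i x) (fun i _ => hk0 i x)
          (mem_univ k)
      rw [hz] at hle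
      rw [le_antisymm hle (hk0 k x), hz, zero_mul]
    · rw [mul_div_cancel₀ _ hz]
  -- the label row mass `s(y) = Σ_j c_jφ_j(y)/κ(y) ∈ [0, 1]`
  set s : X → ℝ := fun y => ∑ j : Fin (D + 1), c j * φ j y / κ y with hs
  have hs1 : ∀ y, s y ≤ 1 := fun y => by
    simp only [hs]
    rw [← sum_div, sum_fin_weight_eq_mixture]
    exact div_self_le_one _
  -- the configuration part `B(x,y) = Σ_k c_kφ_k(x) T_k(x,y) ≥ 0`
  set B : X → X → ℝ := fun x y => ∑ k : Fin (D + 1), c k * φ k x * mhKernel R (φ k) x y with hB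
  have hB0 : ∀ x y, 0 ≤ B x y := fun x y => sum_nonneg fun k _ => mul_nonneg (hk0 k x) (hT0 k x y)
  -- Step 1: `2𝓔_ψ(f) = Σ_x Σ_y B(x,y) s(y) (g x − g y)²`
  have h1 : dirichletForm (temperingLaw c φ D) (temperingChain R c φ D) (fun p => g p.1)
      = 1 / 2 * ∑ x, ∑ y, B x y * s y * (g x - g y) ^ 2 := by
    unfold dirichletForm
    congr 1
    rw [Fintype.sum_prod_type]
    refine sum_congr rfl fun x _ => ?_
    simp only [Fintype.sum_prod_type]
    rw [sum_comm]
    refine sum_congr rfl fun y _ => ?_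
    -- per `(x, y)`: `Σ_i Σ_j ψ(x,i) (QPQ)((x,i),(y,j)) (g x − g y)² = B(x,y) s(y) (g x − g y)²`
    have hM : ∀ i j : Fin (D + 1), temperingChain R c φ D (x, i) (y, j)
        = (∑ k : Fin (D + 1), c k * φ k x / κ x * mhKernel R (φ k) x y) * (c j * φ j y / κ y) := by
      intro i j
      rw [temperingChain_apply, sum_mul]
    have hA : κ x * ∑ k : Fin (D + 1), c k * φ k x / κ x * mhKernel R (φ k) x y = B x y := by
      simp only [hB]
      rw [mul_sum]
      exact sum_congr rfl fun k _ => by rw [← mul_assoc, hcancel k x]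
    simp only [temperingLaw]
    simp_rw [hM]
    calc ∑ i : Fin (D + 1), ∑ j : Fin (D + 1), c i * φ i x
          * ((∑ k : Fin (D + 1), c k * φ k x / κ x * mhKernel R (φ k) x y) * (c j * φ j y / κ y))
          * (g x - g y) ^ 2
        = (∑ i : Fin (D + 1), c i * φ i x)
          * ((∑ k : Fin (D + 1), c k * φ k x / κ x * mhKernel R (φ k) x y) * (g x - g y) ^ 2 * s y) := by
          rw [sum_mul]
          refine sum_congr rfl fun i _ => ?_
          simp only [hs]
          rw [mul_sum, mul_sum]
          exact sum_congr rfl fun j _ => by ring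
      _ = B x y * s y * (g x - g y) ^ 2 := by
          rw [sum_fin_weight_eq_mixture, ← hκ, ← hA]
          ring
  -- Step 2: drop `s(y) ≤ 1`
  have h2 : ∑ x, ∑ y, B x y * s y * (g x - g y) ^ 2 ≤ ∑ x, ∑ y, B x y * (g x - g y) ^ 2 :=
    sum_le_sum fun x _ => sum_le_sum fun y _ => by
      rw [mul_right_comm]
      exact mul_le_of_le_one_right (mul_nonneg (hB0 x y) (sq_nonneg _)) (hs1 y)
  -- Step 3: `½ Σ_x Σ_y B(x,y)(g x − g y)² = Σ_k c_k 𝓔_k(g)`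
  have h3 : 1 / 2 * ∑ x, ∑ y, B x y * (g x - g y) ^ 2
      = ∑ k ∈ range (D + 1), c k * dirichletForm (φ k) (mhKernel R (φ k) : Matrix X X ℝ) g := by
    rw [← Fin.sum_univ_eq_sum_range (fun k => c k * dirichletForm (φ k)
      (mhKernel R (φ k) : Matrix X X ℝ) g) (D + 1)]
    have hk : ∀ k : Fin (D + 1), c k * dirichletForm (φ k) (mhKernel R (φ k) : Matrix X X ℝ) g
        = 1 / 2 * ∑ x, ∑ y, c k * φ k x * mhKernel R (φ k) x y * (g x - g y) ^ 2 := by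
      intro k
      unfold dirichletForm
      rw [mul_left_comm, mul_sum]
      congr 1
      refine sum_congr rfl fun x _ => ?_
      rw [mul_sum]
      exact sum_congr rfl fun y _ => by
        rw [show (mhKernel R (φ ↑k) : Matrix X X ℝ) x y = mhKernel R (φ k) x y from rfl]
        ring
    simp_rw [hk]
    rw [← mul_sum]
    congr 1
    simp only [hB]
    simp_rw [sum_mul]
    calc ∑ x, ∑ y, ∑ k : Fin (D + 1), c k * φ k x * mhKernel R (φ k) x y * (g x - g y) ^ 2
        = ∑ x, ∑ k : Fin (D + 1), ∑ y, c k * φ k x * mhKernel R (φ k) x y * (g x - g y) ^ 2 :=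
          sum_congr rfl fun x _ => sum_comm
      _ = _ := sum_comm
  calc dirichletForm (temperingLaw c φ D) (temperingChain R c φ D) (fun p => g p.1)
      = 1 / 2 * ∑ x, ∑ y, B x y * s y * (g x - g y) ^ 2 := h1
    _ ≤ 1 / 2 * ∑ x, ∑ y, B x y * (g x - g y) ^ 2 := mul_le_mul_of_nonneg_left h2 (by norm_num)
    _ = ∑ k ∈ range (D + 1), c k * dirichletForm (φ k) (mhKernel R (φ k) : Matrix X X ℝ) g := h3
    _ ≤ _ := dirichletForm_mixture_ge hc (fun j _ => hφ j) hR g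

/-- **PROPOSITION 3.2 (Madras–Piccioni): umbrella sampling is at least as good as simulated
tempering**, `Gap(QPQ) ≤ Gap(R[κ])`: the simulated tempering chain built from the Metropolis–Hastings
chains `T_i = R[φ_i]` and weights `c_i` mixes no faster (in spectral gap) than the single
Metropolis–Hastings chain for the umbrella density `κ = Σ c_iφ_i`.  Finite version for any proposal
matrix `R ≥ 0` with row sums `≤ 1`, weights `c_i ≥ 0` adding up to `1`, probability vectors `φ_i`,
and `κ` not a point mass (some set has `κ`-mass in `(0, ½]`).
[cite: MadrasRandall2002, §3 Proposition 3.2; Appendix B (proof)] -/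
theorem MadrasRandall2002_prop_3_2 {c : ℕ → ℝ} {φ : ℕ → X → ℝ} {D : ℕ} (hc : ∀ j ≤ D, 0 ≤ c j)
    (hc1 : ∑ j ∈ range (D + 1), c j = 1) (hφ : ∀ j, ∀ x, 0 ≤ φ j x) (hφ1 : ∀ j, ∑ x, φ j x = 1)
    {R : X → X → ℝ} (hR : ∀ x y, 0 ≤ R x y) (hRrow : ∀ x, ∑ y, R x y ≤ 1)
    (hX : ∃ S : Finset X, 0 < ∑ x ∈ S, mixture c φ D x ∧ ∑ x ∈ S, mixture c φ D x ≤ 1 / 2) :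
    spectralGapR (temperingLaw c φ D) (temperingChain R c φ D)
      ≤ spectralGapR (mixture c φ D) (mhKernel R (mixture c φ D) : Matrix X X ℝ) := by
  have hκ1 : ∑ x, mixture c φ D x = 1 := sum_mixture hc1 fun j _ => hφ1 j
  have hψ0 : ∀ p : X × Fin (D + 1), 0 ≤ temperingLaw c φ D p := fun p =>
    mul_nonneg (hc p.2 (Nat.lt_succ_iff.mp p.2.isLt)) (hφ p.2 p.1)
  have hM0 := temperingChain_nonneg hc hφ hR hRrow (D := D)
  obtain ⟨g₀, hg₀0, hg₀1⟩ := exists_mean_zero_piInner_one hκ1 hX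
  refine le_csInf ⟨_, ⟨g₀, ⟨hg₀0, hg₀1⟩, rfl⟩⟩ ?_
  rintro _ ⟨g, ⟨hg0, hg1⟩, rfl⟩
  -- the label-free lift `f(x,i) = g(x)` is admissible for `ψ`
  have hf0 : ∑ p : X × Fin (D + 1), temperingLaw c φ D p * g p.1 = 0 := by
    rw [sum_temperingLaw_mul_comp_fst, hg0]
  have hf1 : piInner (temperingLaw c φ D) (fun p => g p.1) (fun p => g p.1) = 1 := by
    rw [piInner_temperingLaw_comp_fst, hg1]
  exact (spectralGapR_le_dirichletForm hψ0 hM0 hf0 hf1).trans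
    (dirichletForm_temperingChain_comp_fst_le hc hφ hR hRrow g)

end Literature.Probability.MarkovChains.DensityDecomposition

/-! # Fourth block: §4, eqs. (25)–(31) — the umbrella density of an overlapping cover and
# `Θ⁻¹ Gap(P) ≤ Gap(P[κ]) ≤ Θ Gap(P)`

[cite: MadrasRandall2002, §4 eqs. (25)–(31)].  Setting of the State Decomposition Theorem: `P`
reversible with respect to a positive probability vector `π`, subsets `A_0, …, A_D` covering the state
space, `φ_i = π 1_{A_i}/π[A_i]` (25), `Z = Σ_i π[A_i]`, `Θ ≥ max_x #{i : x ∈ A_i}` (26),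
`c_i = π[A_i]/Z` (27), `κ = Σ_i c_i φ_i` (28).  PROVED: (29) `π/Z ≤ κ ≤ Θπ/Z` (`coverMixture_ge`,
`coverMixture_le`), (30) `P[π] = P` (`mhKernel_eq_self_of_detailedBalance`), and **(31)
`Θ⁻¹ Gap(P) ≤ Gap(P[κ]) ≤ Θ Gap(P)`** (`MadrasRandall2002_eq_31`, from Lemma 3.1).  NOT typed: the rest
of §4 (eqs. (32)–(39)) and Theorem 1.1 itself, whose proof goes through Theorem 2.1
(Caracciolo–Pelissetto–Sokal, Appendix A: operator square roots and `Spec(AB) ∖ {0} = Spec(BA) ∖ {0}`). -/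

namespace Literature.Probability.MarkovChains.DensityDecomposition

open Finset Matrix

variable {X : Type*} [Fintype X] [DecidableEq X]

/-- **Eq. (30)**: a `π`-reversible stochastic matrix is its own Metropolis–Hastings chain, `P[π] = P`
(`π > 0`). [cite: MadrasRandall2002, §4 eq. (30)] -/
theorem mhKernel_eq_self_of_detailedBalance {π : X → ℝ} (hπ : ∀ x, 0 < π x) {P : X → X → ℝ}
    (hDB : DetailedBalance π P) (hrow : ∀ x, ∑ y, P x y = 1) : mhKernel P π = P := by
  funext x y
  have hrate : ∀ z, z ≠ x → mhRate P π x z = P x z := fun z _ => by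
    unfold mhRate
    rw [← hDB x z, mul_comm (π x), mul_div_assoc, div_self (hπ x).ne', mul_one, min_self]
  by_cases h : y = x
  · subst h
    rw [mhKernel_self, sum_congr rfl fun z hz => hrate z (ne_of_mem_erase hz)]
    have := hrow y
    rw [← sum_erase_add _ _ (mem_univ y)] at this
    linarith
  · rw [mhKernel_of_ne h, hrate y h]

/-- The mass `π[A] = Σ_{x ∈ A} π(x)` of a piece. [cite: MadrasRandall2002, §1 (notation `π[A_i]`)] -/
def pieceMass (π : X → ℝ) (A : Finset X) : ℝ := ∑ x ∈ A, π x

/-- **Eq. (25)**: the normalized restriction `φ_A = π 1_A / π[A]`.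
[cite: MadrasRandall2002, §4 eq. (25)] -/
noncomputable def pieceLaw (π : X → ℝ) (A : Finset X) (x : X) : ℝ :=
  if x ∈ A then π x / pieceMass π A else 0

/-- The multiplicity `N(x) = #{i ≤ D : x ∈ A_i}` of the cover at `x`.
[cite: MadrasRandall2002, §1 eq. (26) (`Θ = max_x |{i : x ∈ A_i}|`)] -/
def coverCount (A : ℕ → Finset X) (D : ℕ) (x : X) : ℕ := ((range (D + 1)).filter fun i => x ∈ A i).card

omit [Fintype X] in
/-- `φ_A ≥ 0` for `π ≥ 0`. [cite: MadrasRandall2002, §4 eq. (25)] -/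
theorem pieceLaw_nonneg {π : X → ℝ} (hπ : ∀ x, 0 ≤ π x) (A : Finset X) (x : X) :
    0 ≤ pieceLaw π A x := by
  unfold pieceLaw
  split_ifs
  · exact div_nonneg (hπ x) (sum_nonneg fun y _ => hπ y)
  · exact le_rfl

/-- `Σ_x φ_A(x) = 1` when `π[A] ≠ 0`. [cite: MadrasRandall2002, §4 eq. (25)] -/
theorem sum_pieceLaw {π : X → ℝ} {A : Finset X} (hA : pieceMass π A ≠ 0) :
    ∑ x, pieceLaw π A x = 1 := by
  unfold pieceLaw
  rw [← sum_filter, filter_mem_eq_inter, univ_inter, ← sum_div]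
  exact div_self hA

omit [Fintype X] in
/-- **Eq. (28) computed**: with `c_i = π[A_i]/Z`, `κ(x) = Σ_i c_i φ_i(x) = π(x) N(x)/Z`.
[cite: MadrasRandall2002, §4 eqs. (27)–(28)] -/
theorem coverMixture_eq {π : X → ℝ} {A : ℕ → Finset X} {D : ℕ}
    (hA : ∀ i ≤ D, pieceMass π (A i) ≠ 0) (Z : ℝ) (x : X) :
    mixture (fun i => pieceMass π (A i) / Z) (fun i => pieceLaw π (A i)) D x
      = π x * coverCount A D x / Z := by
  unfold mixture
  beta_reduce
  -- each summand: `(π[A_i]/Z) φ_i(x) = 1_{A_i}(x) π(x)/Z`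
  have hterm : ∀ i ∈ range (D + 1),
      pieceMass π (A i) / Z * pieceLaw π (A i) x = if x ∈ A i then π x / Z else 0 := by
    intro i hi
    unfold pieceLaw
    split_ifs with hx
    · rw [div_mul_div_comm, mul_comm (pieceMass π (A i)),
        mul_div_mul_right _ _ (hA i (Nat.lt_succ_iff.mp (mem_range.mp hi)))]
    · rw [mul_zero]
  rw [sum_congr rfl hterm, ← sum_filter, sum_const, nsmul_eq_mul]
  unfold coverCount
  ring

omit [Fintype X] in
/-- **Eq. (29), lower half**: `π(x)/Z ≤ κ(x)` for a cover (`N(x) ≥ 1`), `π ≥ 0`, `Z > 0`.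
[cite: MadrasRandall2002, §4 eq. (29)] -/
theorem coverMixture_ge {π : X → ℝ} (hπ : ∀ x, 0 ≤ π x) {A : ℕ → Finset X} {D : ℕ}
    (hA : ∀ i ≤ D, pieceMass π (A i) ≠ 0) (hcover : ∀ x, ∃ i ≤ D, x ∈ A i) {Z : ℝ} (hZ : 0 < Z)
    (x : X) :
    1 / Z * π x ≤ mixture (fun i => pieceMass π (A i) / Z) (fun i => pieceLaw π (A i)) D x := by
  rw [coverMixture_eq hA Z x]
  have hN : (1 : ℝ) ≤ coverCount A D x := by
    obtain ⟨i, hi, hx⟩ := hcover x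
    have : 1 ≤ coverCount A D x :=
      card_pos.mpr ⟨i, mem_filter.mpr ⟨mem_range.mpr (Nat.lt_succ_of_le hi), hx⟩⟩
    exact_mod_cast this
  rw [one_div_mul_eq_div]
  exact div_le_div_of_nonneg_right (le_mul_of_one_le_right (hπ x) hN) hZ.le

omit [Fintype X] in
/-- **Eq. (29), upper half**: `κ(x) ≤ Θπ(x)/Z` when every point lies in at most `Θ` pieces.
[cite: MadrasRandall2002, §4 eq. (29)] -/
theorem coverMixture_le {π : X → ℝ} (hπ : ∀ x, 0 ≤ π x) {A : ℕ → Finset X} {D : ℕ}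
    (hA : ∀ i ≤ D, pieceMass π (A i) ≠ 0) {Θ : ℕ} (hΘ : ∀ x, coverCount A D x ≤ Θ) {Z : ℝ}
    (hZ : 0 < Z) (x : X) :
    mixture (fun i => pieceMass π (A i) / Z) (fun i => pieceLaw π (A i)) D x ≤ Θ / Z * π x := by
  rw [coverMixture_eq hA Z x, div_mul_eq_mul_div, mul_comm (Θ : ℝ)]
  exact div_le_div_of_nonneg_right (mul_le_mul_of_nonneg_left (by exact_mod_cast hΘ x) (hπ x)) hZ.le

/-- **Eq. (31)**: for the umbrella density `κ` of an overlapping cover `A_0, …, A_D` (each point in at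
least one and at most `Θ` pieces, `π > 0`, `P` `π`-reversible and stochastic with `P ≥ 0`),
**`Θ⁻¹ Gap(P) ≤ Gap(P[κ]) ≤ Θ Gap(P)`** — Lemma 3.1 with `π/Z ≤ κ ≤ Θπ/Z` and `P[π] = P`.
[cite: MadrasRandall2002, §4 eq. (31)] -/
theorem MadrasRandall2002_eq_31 {π : X → ℝ} (hπ : ∀ x, 0 < π x) (hπ1 : ∑ x, π x = 1)
    {P : X → X → ℝ} (hP : ∀ x y, 0 ≤ P x y) (hrow : ∀ x, ∑ y, P x y = 1)
    (hDB : DetailedBalance π P) {A : ℕ → Finset X} {D : ℕ} (hA : ∀ i ≤ D, 0 < pieceMass π (A i))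
    (hcover : ∀ x, ∃ i ≤ D, x ∈ A i) {Θ : ℕ} (hΘ : ∀ x, coverCount A D x ≤ Θ) :
    let κ := mixture (fun i => pieceMass π (A i) / ∑ j ∈ range (D + 1), pieceMass π (A j))
      (fun i => pieceLaw π (A i)) D
    1 / Θ * spectralGapR π (P : Matrix X X ℝ) ≤ spectralGapR κ (mhKernel P κ : Matrix X X ℝ) ∧
      spectralGapR κ (mhKernel P κ : Matrix X X ℝ) ≤ Θ * spectralGapR π (P : Matrix X X ℝ) := by
  intro κ
  set Z := ∑ j ∈ range (D + 1), pieceMass π (A j) with hZ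
  have hA' : ∀ i ≤ D, pieceMass π (A i) ≠ 0 := fun i hi => (hA i hi).ne'
  have hZpos : 0 < Z := by
    have h0 : pieceMass π (A 0) ≤ Z :=
      single_le_sum (f := fun j => pieceMass π (A j)) (fun j hj => (hA j
        (Nat.lt_succ_iff.mp (mem_range.mp hj))).le) (mem_range.mpr (Nat.succ_pos D))
    linarith [hA 0 (Nat.zero_le D)]
  have hπ0 : ∀ x, 0 ≤ π x := fun x => (hπ x).le
  -- `κ` is a probability vector with `π/Z ≤ κ ≤ Θπ/Z`
  have hc0 : ∀ i ≤ D, 0 ≤ pieceMass π (A i) / Z := fun i hi => div_nonneg (hA i hi).le hZpos.le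
  have hc1 : ∑ i ∈ range (D + 1), pieceMass π (A i) / Z = 1 := by
    rw [← sum_div, ← hZ, div_self hZpos.ne']
  have hκ0 : ∀ x, 0 ≤ κ x := mixture_nonneg hc0 fun i _ => pieceLaw_nonneg hπ0 (A i)
  have hκ1 : ∑ x, κ x = 1 := sum_mixture hc1 fun i hi => sum_pieceLaw (hA' i hi)
  have hlo : ∀ x, 1 / Z * π x ≤ κ x := coverMixture_ge hπ0 hA' hcover hZpos
  have hhi : ∀ x, κ x ≤ Θ / Z * π x := coverMixture_le hπ0 hA' hΘ hZpos
  -- `Θ ≥ 1` (the cover is nonempty at some point)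
  obtain ⟨x₀⟩ : Nonempty X := by
    by_contra h
    rw [not_nonempty_iff] at h
    rw [univ_eq_empty, sum_empty] at hπ1
    exact zero_ne_one hπ1
  have hΘ1 : (1 : ℝ) ≤ Θ := by
    obtain ⟨i, hi, hx⟩ := hcover x₀
    have : 1 ≤ coverCount A D x₀ :=
      card_pos.mpr ⟨i, mem_filter.mpr ⟨mem_range.mpr (Nat.lt_succ_of_le hi), hx⟩⟩
    exact_mod_cast this.trans (hΘ x₀)
  have hΘpos : (0 : ℝ) < Θ := by linarith
  -- Lemma 3.1 with `r₁ = κ`, `r₂ = π`, `a = 1/Z`, `b = Θ/Z`, and `P[π] = P`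
  have h := MadrasRandall2002_lemma_3_1 hκ0 hπ0 hκ1 hπ1 hP (fun x => (hrow x).le)
    (one_div_pos.mpr hZpos) (div_pos hΘpos hZpos) fun x => ⟨hlo x, hhi x⟩
  have hself : (mhKernel P π : Matrix X X ℝ) = (P : Matrix X X ℝ) :=
    mhKernel_eq_self_of_detailedBalance hπ hDB hrow
  rw [hself] at h
  have e1 : 1 / Z / (Θ / Z) = 1 / Θ := by field_simp
  have e2 : Θ / Z / (1 / Z) = Θ := by field_simp
  rw [e1, e2] at h
  exact h

end Literature.Probability.MarkovChains.DensityDecomposition
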